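import Literature.NumberTheory.LFunctions.MauduitRivatTypeIIParams
import Literature.NumberTheory.LFunctions.MauduitRivatTypeI
import Literature.NumberTheory.LFunctions.MoebiusVaughanSeparation
import Literature.NumberTheory.LFunctions.MoebiusVaughanTypeReduction
import Literature.NumberTheory.LFunctions.MauduitRivatMoebiusDigital
import HarnessLib

/-!
# Mauduit–Rivat's Theorem 2 in base 2 — proof of `mauduitRivat2015_thm2_base2` (proved)

Everything in this file is PROVED; it discharges the named fact
`Literature.NumberTheory.LFunctions.mauduitRivat2015_thm2_base2` (C. Mauduit, J. Rivat,
*Prime numbers along Rudin–Shapiro sequences*, J. Eur. Math. Soc. 17 (2015), Theorem 2 with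
(10), base `q = 2`) as `mauduitRivat2015_thm2_base2_holds`, following MR's proof (§8): the
Vaughan-type identity on each hyperbolic piece `x/2^{i+1} < n ≤ x/2^i`
(`MRVaughan.norm_sum_moebius_smul_le_blocks`, with `u = 2^{⌊L/3⌋}`, `L = ⌊log₂ x⌋`), MR's
Proposition 1 for the type-I blocks `M ≤ 2^{L/3+1}` (`typeI_sum_le`) and MR's Proposition 2
(in C. Müllner's matrix form, here for `1 × 1` unitary matrices `U(z) = z · 1`, `z ∈ 𝕊¹`;
`typeIISq_le_params`) for the type-II blocks, after the separation of the hyperbolic constraint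
(`MRVaughan.blockII_le_of_boxII`).

* `exists_circle_unitaryHom`, `hasFourierProperty_umat_circle` — `𝕊¹ → U(1)` and the transfer
  of the Fourier property; `gamma_le_half` — MR (26): `γ(λ) ≤ λ/2` (Parseval);
* `boxII_eq_typeIISq`, `blockI_eq_sum_norm` — the block quantities of the Vaughan-type reduction
  for `g(n) = e(ϑn) f(n)` are the matrix quantities;
* **`typeIISq_base2_block`** — Prop. 2 for a dyadic block with MR's choice (86)–(90) of the
  parameters: `ρ = min(⌊5μ/71⌋, ⌊5ν/58⌋)`, `ρ' = min(⌊ρ/10⌋, ⌊(γ(2ρ) − 3t)/10⌋)`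
  (`2^{t−1} ≤ μ + 2ρ + 1 < 2^t`; the slack `3t` absorbs the powers of `log` and `τ`, cf. the
  docstring of `MauduitRivatTypeIIParams`; when `γ(2ρ) < 3t + 10` the trivial bound is already
  as good), valid for `L ≥ 1024` on the whole type-II range `L/3 < μ ≤ L − L/3 + 1`, whether
  `M ≤ N` or not: `T ≤ K(C) 2^μ 4^ν L^{3/10} 2^{−γ(λ₀)/10}` for every `λ₀ ≤ L/25`;
* **`blockI_base2_le`** — Prop. 1 for a block `j ≤ L/3` (`κ = 2j+2`, `λ = L − 2j − 1`,
  `ρ₁ = ⌊γ(λ)⌋`): `≤ 8(1 + 2√2√C) x Λ²√Λ 2^{−γ(λ₀)/2}`, `Λ = 1 + log 2x`;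
* `typeI_term_le`, `typeII_term_le`, **`piece_le`** — the terms of the reduction and a whole
  hyperbolic piece: `‖∑_{x/2<n≤x} μ(n) e(ϑn) f(n)‖ ≤ K_p(C) x (1 + log 2x)⁴ 2^{−γ(λ₀)/20}` for
  `L ≥ 1024`, `λ₀ ≤ L/25`, `γ(λ₀) ≥ 0` (the `log`-budget: `τ`-Cauchy–Schwarz `3/2`, separation
  `1`, number of blocks `1`, Prop. 2 `≤ 1/2`);
* **`mauduitRivat2015_thm2_base2_holds`** — pieces `i ≤ L/4` (so that
  `2⌊log x/(80 log 2)⌋ ≤ (L − i)/25`), the deeper pieces and `L < 1400` trivially (using (26)),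
  with `K = 32 K_p(C) + 10`.

## References
* C. Mauduit, J. Rivat, *Prime numbers along Rudin–Shapiro sequences*, J. Eur. Math. Soc. 17
  (2015), Theorem 2, (10), (26), Prop. 1–2, §8. [MauduitRivat2015]
* C. Müllner, *Automatic sequences fulfill the Sarnak conjecture*, Duke Math. J. 166 (2017),
  §4–5. [Mullner2017]
-/

noncomputable section

open Finset Complex Matrix

open scoped FourierTransform InnerProductSpace ComplexConjugate Matrix.Norms.Frobenius

namespace Literature.NumberTheory.LFunctions.MauduitRivat

open Literature.NumberTheory.LFunctions.MRVaughan (boxII blockI blockII hypCut hypCut_apply sepRange)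

/-! ## The unitary `1 × 1` matrices attached to the unit circle -/

/-- There is a monoid hom `U : 𝕊¹ → U(1)` with `U(z) = z · 1`. [folklore] -/
theorem exists_circle_unitaryHom :
    ∃ U : Circle →* unitaryGroup (Fin 1) ℂ,
      ∀ z : Circle, (U z : Matrix (Fin 1) (Fin 1) ℂ) = (z : ℂ) • (1 : Matrix (Fin 1) (Fin 1) ℂ) := by
  have hmem : ∀ z : Circle, (z : ℂ) • (1 : Matrix (Fin 1) (Fin 1) ℂ) ∈ unitaryGroup (Fin 1) ℂ := by
    intro z
    rw [Matrix.mem_unitaryGroup_iff, star_eq_conjTranspose, conjTranspose_smul, conjTranspose_one,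
      smul_mul_assoc, one_mul, smul_smul]
    have : (z : ℂ) * star (z : ℂ) = 1 := by
      rw [Complex.star_def, Complex.mul_conj, Circle.normSq_coe, Complex.ofReal_one]
    rw [this, one_smul]
  refine ⟨{ toFun := fun z => ⟨(z : ℂ) • (1 : Matrix (Fin 1) (Fin 1) ℂ), hmem z⟩,
            map_one' := ?_, map_mul' := ?_ }, fun z => rfl⟩
  · apply Subtype.ext
    simp
  · intro x y
    apply Subtype.ext
    change ((x * y : Circle) : ℂ) • (1 : Matrix (Fin 1) (Fin 1) ℂ) =
      ((x : ℂ) • (1 : Matrix (Fin 1) (Fin 1) ℂ)) * ((y : ℂ) • (1 : Matrix (Fin 1) (Fin 1) ℂ))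
    rw [smul_mul_assoc, one_mul, smul_smul, Circle.coe_mul]

/-- `‖z · 1‖_F = |z|` for `1 × 1` matrices. [folklore] -/
theorem norm_smul_one_fin_one (z : ℂ) : ‖z • (1 : Matrix (Fin 1) (Fin 1) ℂ)‖ = ‖z‖ := by
  rw [norm_smul, frobenius_norm_one, Fintype.card_fin, Nat.cast_one, Real.sqrt_one, mul_one]

/-- `∑ (c_n · 1) = (∑ c_n) · 1`. [folklore] -/
theorem sum_smul_one_fin_one (s : Finset ℕ) (c : ℕ → ℂ) :
    ∑ n ∈ s, c n • (1 : Matrix (Fin 1) (Fin 1) ℂ) = (∑ n ∈ s, c n) • (1 : Matrix (Fin 1) (Fin 1) ℂ) := by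
  rw [Finset.sum_smul]

variable {U : Circle →* unitaryGroup (Fin 1) ℂ}

/-- `umat U f n = f(n) · 1`. [folklore] -/
theorem umat_circle_apply (hU : ∀ z : Circle, (U z : Matrix (Fin 1) (Fin 1) ℂ) = (z : ℂ) • 1)
    (f : ℕ → Circle) (n : ℕ) : umat U f n = ((f n : Circle) : ℂ) • (1 : Matrix (Fin 1) (Fin 1) ℂ) :=
  hU (f n)

/-- **The Fourier property passes from `f` to `U ∘ f`.** [folklore] -/
theorem hasFourierProperty_umat_circle (hU : ∀ z : Circle, (U z : Matrix (Fin 1) (Fin 1) ℂ) = (z : ℂ) • 1)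
    {k : ℕ} {γ : ℝ → ℝ} {c : ℝ} {f : ℕ → Circle}
    (hf : HasFourierProperty k γ c (fun n => ((f n : Circle) : ℂ))) :
    HasFourierProperty k γ c (umat U f) := by
  intro α lam hα t
  have h := hf α lam hα t
  have e : ((k : ℝ) ^ lam)⁻¹ • ∑ u ∈ range (k ^ lam), (𝐞 (-((u : ℝ) * t)) : ℂ) • umat U f (u * k ^ α) =
      (((k : ℝ) ^ lam)⁻¹ • ∑ u ∈ range (k ^ lam), (𝐞 (-((u : ℝ) * t)) : ℂ) • ((f (u * k ^ α) : Circle) : ℂ)) •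
        (1 : Matrix (Fin 1) (Fin 1) ℂ) := by
    simp only [umat_circle_apply hU, smul_smul, sum_smul_one_fin_one, smul_assoc, smul_eq_mul]
  rw [e, norm_smul_one_fin_one]
  simpa using h

/-- **MR (26)**: for a unimodular `f` with the Fourier property (`c ≥ 0`, `k ≥ 2`), `γ(λ) ≤ λ/2`
for every natural `λ` (Parseval). [cite: MauduitRivat2015, (26)] -/
theorem gamma_le_half {k : ℕ} (hk : 2 ≤ k) {γ : ℝ → ℝ} {c : ℝ} (hc : 0 ≤ c) {f : ℕ → ℂ}
    (hf1 : ∀ n, ‖f n‖ = 1) (hf : HasFourierProperty k γ c f) (lam : ℕ) :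
    γ lam ≤ lam / 2 := by
  have hk0 : 0 < k := by omega
  have hkR : (1 : ℝ) < k := by exact_mod_cast hk
  have hK : 0 < k ^ lam := pow_pos hk0 _
  have hKR : (0 : ℝ) < (k : ℝ) ^ lam := by positivity
  -- Parseval
  have hpar := sum_norm_sq_dftR hK f 0
  have hone : ((k ^ lam : ℕ) : ℝ)⁻¹ * ∑ u ∈ range (k ^ lam), ‖f u‖ ^ 2 = 1 := by
    simp only [hf1, one_pow, sum_const, card_range, nsmul_eq_mul, mul_one]
    rw [inv_mul_cancel₀]
    exact_mod_cast hK.ne'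
  rw [hone] at hpar
  -- each term is at most `k^{-2γ}`
  have hle : ∑ h ∈ range (k ^ lam), ‖dftR (k ^ lam) f ((h : ℝ) + 0)‖ ^ 2 ≤
      ∑ _h ∈ range (k ^ lam), ((k : ℝ) ^ (-γ lam)) ^ 2 :=
    sum_le_sum fun h _ => pow_le_pow_left₀ (norm_nonneg _) (hf.norm_dftR_le hc lam _) 2
  rw [sum_const, card_range, nsmul_eq_mul, hpar] at hle
  by_contra hneg
  push Not at hneg
  have hlt : (k : ℝ) ^ (-γ lam) < (k : ℝ) ^ (-((lam : ℝ) / 2)) :=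
    Real.rpow_lt_rpow_of_exponent_lt hkR (by linarith)
  have hpos : 0 < (k : ℝ) ^ (-γ lam) := Real.rpow_pos_of_pos (by linarith) _
  have hsq : ((k : ℝ) ^ (-γ lam)) ^ 2 < ((k : ℝ) ^ (-((lam : ℝ) / 2))) ^ 2 :=
    pow_lt_pow_left₀ hlt hpos.le (by norm_num)
  have e : ((k : ℝ) ^ (-((lam : ℝ) / 2))) ^ 2 = ((k : ℝ) ^ lam)⁻¹ := by
    rw [← Real.rpow_natCast ((k : ℝ) ^ (-((lam : ℝ) / 2))) 2, ← Real.rpow_mul (by linarith)]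
    rw [show (-((lam : ℝ) / 2)) * ((2 : ℕ) : ℝ) = -(lam : ℝ) by push_cast; ring, Real.rpow_neg (by linarith),
      Real.rpow_natCast]
  rw [e] at hsq
  have : ((k ^ lam : ℕ) : ℝ) * ((k : ℝ) ^ (-γ lam)) ^ 2 < 1 := by
    calc ((k ^ lam : ℕ) : ℝ) * ((k : ℝ) ^ (-γ lam)) ^ 2 < ((k ^ lam : ℕ) : ℝ) * ((k : ℝ) ^ lam)⁻¹ :=
          mul_lt_mul_of_pos_left hsq (by positivity)
      _ = 1 := by push_cast; rw [mul_inv_cancel₀ hKR.ne']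
  linarith

/-! ## The scalar block quantities as `1 × 1`-matrix quantities -/

/-- **`boxII = typeIISq`** for `g(n) = e(ϑn) f(n)` and `B_n = c_n · 1`. [folklore] -/
theorem boxII_eq_typeIISq (hU : ∀ z : Circle, (U z : Matrix (Fin 1) (Fin 1) ℂ) = (z : ℂ) • 1)
    (f : ℕ → Circle) (ϑ : ℝ) (q j i : ℕ) (c : ℕ → ℂ) :
    boxII q j i c (fun n => (𝐞 (ϑ * n) : ℂ) * ((f n : Circle) : ℂ)) =
      typeIISq ϑ (fun n => c n • (1 : Matrix (Fin 1) (Fin 1) ℂ)) (umat U f)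
        (q ^ j) (q ^ (j + 1)) (q ^ i) (q ^ (i + 1)) := by
  unfold boxII typeIISq
  refine sum_congr rfl fun m _ => ?_
  have e : ∑ n ∈ Ico (q ^ i) (q ^ (i + 1)), (𝐞 (ϑ * m * n) : ℂ) • (c n • (1 : Matrix (Fin 1) (Fin 1) ℂ) * umat U f (m * n)) =
      (∑ n ∈ Ico (q ^ i) (q ^ (i + 1)), c n • ((𝐞 (ϑ * ((m * n : ℕ) : ℝ)) : ℂ) * ((f (m * n) : Circle) : ℂ))) •
        (1 : Matrix (Fin 1) (Fin 1) ℂ) := by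
    rw [← sum_smul_one_fin_one]
    refine sum_congr rfl fun n _ => ?_
    rw [umat_circle_apply hU, smul_mul_assoc, one_mul, smul_smul, smul_smul]
    congr 1
    rw [smul_eq_mul]
    push_cast
    ring
  rw [e, norm_smul_one_fin_one]

/-- The inner sum of `blockI` as a sum over multiples in `(x/q, x]`. [folklore] -/
theorem sum_hypCut_mul_eq {E : Type*} [NormedAddCommGroup E] {q x a : ℕ} (hq : 0 < q) (ha : 0 < a)
    (g : ℕ → E) :
    ∑ b ∈ Ioc 0 x, hypCut q x g (a * b) = ∑ ℓ ∈ (Ioc (x / q) x).filter (fun ℓ => a ∣ ℓ), g ℓ := by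
  have h1 : ∑ b ∈ Ioc 0 x, hypCut q x g (a * b) =
      ∑ b ∈ (Ioc 0 x).filter (fun b => x < q * (a * b) ∧ a * b ≤ x), g (a * b) := by
    rw [sum_filter]
    refine sum_congr rfl fun b _ => ?_
    rw [hypCut_apply]
  rw [h1]
  refine sum_nbij' (fun b => a * b) (fun ℓ => ℓ / a) ?_ ?_ ?_ ?_ ?_
  · intro b hb
    simp only [mem_filter, mem_Ioc] at hb ⊢
    refine ⟨⟨(Nat.div_lt_iff_lt_mul hq).2 (by linarith [hb.2.1]), hb.2.2⟩, dvd_mul_right a b⟩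
  · intro ℓ hℓ
    simp only [mem_filter, mem_Ioc] at hℓ ⊢
    obtain ⟨⟨h1, h2⟩, hdvd⟩ := hℓ
    rw [Nat.mul_div_cancel' hdvd]
    have hx : x < ℓ * q := (Nat.div_lt_iff_lt_mul hq).1 h1
    refine ⟨⟨Nat.div_pos (Nat.le_of_dvd (lt_of_le_of_lt (Nat.zero_le _) h1) hdvd) ha,
      (Nat.div_le_self _ _).trans h2⟩,
      by linarith, h2⟩
  · intro b _
    simp only [Nat.mul_div_cancel_left b ha]
  · intro ℓ hℓ
    simp only [mem_filter] at hℓ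
    simp only [Nat.mul_div_cancel' hℓ.2]
  · intro b _
    rfl

/-- **`blockI` as the type-I quantity of `typeI_sum_le`** for `g(n) = e(ϑn) f(n)`. [folklore] -/
theorem blockI_eq_sum_norm (hU : ∀ z : Circle, (U z : Matrix (Fin 1) (Fin 1) ℂ) = (z : ℂ) • 1)
    (f : ℕ → Circle) (ϑ : ℝ) {q : ℕ} (hq : 0 < q) (x j : ℕ) :
    blockI q x j (fun n => (𝐞 (ϑ * n) : ℂ) * ((f n : Circle) : ℂ)) =
      ∑ a ∈ Ico (q ^ j) (q ^ (j + 1)),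
        ‖∑ ℓ ∈ (Ioc (x / q) x).filter (fun ℓ => a ∣ ℓ), (𝐞 (ϑ * ℓ) : ℂ) • umat U f ℓ‖ := by
  unfold blockI
  refine sum_congr rfl fun a ha => ?_
  have ha0 : 0 < a := lt_of_lt_of_le (pow_pos hq j) (mem_Ico.1 ha).1
  rw [sum_hypCut_mul_eq hq ha0]
  have e : ∑ ℓ ∈ (Ioc (x / q) x).filter (fun ℓ => a ∣ ℓ), (𝐞 (ϑ * ℓ) : ℂ) • umat U f ℓ =
      (∑ ℓ ∈ (Ioc (x / q) x).filter (fun ℓ => a ∣ ℓ), (𝐞 (ϑ * ℓ) : ℂ) * ((f ℓ : Circle) : ℂ)) •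
        (1 : Matrix (Fin 1) (Fin 1) ℂ) := by
    rw [← sum_smul_one_fin_one]
    refine sum_congr rfl fun ℓ _ => ?_
    rw [umat_circle_apply hU, smul_smul]
  rw [e, norm_smul_one_fin_one]

/-- The trivial bound `T ≤ d · M' · N'²`. [folklore] -/
theorem typeIISq_le_trivial {d : Type*} [Fintype d] [DecidableEq d] {G : Type*} [Group G]
    (U : G →* unitaryGroup d ℂ) (f : ℕ → G) (ϑ : ℝ) {B : ℕ → Matrix d d ℂ} (hB : ∀ n, ‖B n‖ ≤ 1)
    (M₀ M₁ N₀ N₁ : ℕ) :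
    typeIISq ϑ B (umat U f) M₀ M₁ N₀ N₁ ≤
      ((M₁ - M₀ : ℕ) : ℝ) * ((Fintype.card d : ℝ) * ((N₁ - N₀ : ℕ) : ℝ) ^ 2) := by
  unfold typeIISq
  have hterm : ∀ m ∈ Ico M₀ M₁, ‖∑ n ∈ Ico N₀ N₁, (𝐞 (ϑ * m * n) : ℂ) • (B n * umat U f (m * n))‖ ^ 2 ≤
      (Fintype.card d : ℝ) * ((N₁ - N₀ : ℕ) : ℝ) ^ 2 := by
    intro m _
    have h1 : ‖∑ n ∈ Ico N₀ N₁, (𝐞 (ϑ * m * n) : ℂ) • (B n * umat U f (m * n))‖ ≤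
        ((N₁ - N₀ : ℕ) : ℝ) * Real.sqrt (Fintype.card d) := by
      calc ‖∑ n ∈ Ico N₀ N₁, (𝐞 (ϑ * m * n) : ℂ) • (B n * umat U f (m * n))‖
          ≤ ∑ n ∈ Ico N₀ N₁, ‖(𝐞 (ϑ * m * n) : ℂ) • (B n * umat U f (m * n))‖ := norm_sum_le _ _
        _ ≤ ∑ _n ∈ Ico N₀ N₁, Real.sqrt (Fintype.card d) := by
            refine sum_le_sum fun n _ => ?_
            rw [norm_fourierChar_smul]
            calc ‖B n * umat U f (m * n)‖ ≤ ‖B n‖ * ‖umat U f (m * n)‖ := Matrix.frobenius_norm_mul _ _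
              _ ≤ 1 * Real.sqrt (Fintype.card d) := by
                  refine mul_le_mul (hB n) (le_of_eq (norm_coe_unitary _)) (norm_nonneg _) zero_le_one
              _ = _ := one_mul _
        _ = _ := by rw [sum_const, Nat.card_Ico, nsmul_eq_mul]
    have h0 : 0 ≤ ‖∑ n ∈ Ico N₀ N₁, (𝐞 (ϑ * m * n) : ℂ) • (B n * umat U f (m * n))‖ := norm_nonneg _
    calc ‖∑ n ∈ Ico N₀ N₁, (𝐞 (ϑ * m * n) : ℂ) • (B n * umat U f (m * n))‖ ^ 2
        ≤ (((N₁ - N₀ : ℕ) : ℝ) * Real.sqrt (Fintype.card d)) ^ 2 := pow_le_pow_left₀ h0 h1 2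
      _ = _ := by rw [mul_pow, Real.sq_sqrt (Nat.cast_nonneg _)]; ring
  calc ∑ m ∈ Ico M₀ M₁, ‖∑ n ∈ Ico N₀ N₁, (𝐞 (ϑ * m * n) : ℂ) • (B n * umat U f (m * n))‖ ^ 2
      ≤ ∑ _m ∈ Ico M₀ M₁, (Fintype.card d : ℝ) * ((N₁ - N₀ : ℕ) : ℝ) ^ 2 := sum_le_sum hterm
    _ = _ := by rw [sum_const, Nat.card_Ico, nsmul_eq_mul]


/-! ## Arithmetic for the choice of the parameters in base 2 -/

/-- `64 (s + 1) ≤ 2^s` for `s ≥ 10`. [folklore] -/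
theorem sixtyfour_mul_succ_le_two_pow (s : ℕ) (hs : 10 ≤ s) : 64 * (s + 1) ≤ 2 ^ s := by
  induction s, hs using Nat.le_induction with
  | base => norm_num
  | succ s hs ih =>
    have : 64 ≤ 2 ^ s := le_trans (by norm_num : 64 ≤ 2 ^ 10) (Nat.pow_le_pow_right (by norm_num) hs)
    rw [pow_succ]
    omega

/-- From `2^t ≤ 2n`, `n ≤ L` and `L ≥ 1024`: `64 t ≤ L`. [folklore] -/
theorem sixtyfour_mul_le_of_pow_le {t n L : ℕ} (ht : 2 ^ t ≤ 2 * n) (hn : n ≤ L) (hL : 1024 ≤ L) :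
    64 * t ≤ L := by
  by_cases h : t ≤ 10
  · omega
  · have h1 := sixtyfour_mul_succ_le_two_pow (t - 1) (by omega)
    have e : 2 ^ t = 2 * 2 ^ (t - 1) := by rw [← pow_succ']; congr 1; omega
    have h2 : t - 1 + 1 = t := by omega
    rw [h2] at h1
    omega

/-- `n⁶ ≤ 420⁶ · 2^ρ` whenever `6 ⌊n/210⌋ ≤ ρ`. [folklore] -/
theorem pow_six_le {n ρ : ℕ} (h : 6 * (n / 210) ≤ ρ) : (n : ℝ) ^ 6 ≤ 420 ^ 6 * (2 : ℝ) ^ ρ := by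
  have h1 : n / 210 < 2 ^ (n / 210) := Nat.lt_two_pow_self
  have h2 : n ≤ 420 * 2 ^ (n / 210) := by
    have h3 : n < 210 * (n / 210 + 1) := by omega
    have h4 : n / 210 + 1 ≤ 2 * 2 ^ (n / 210) := by omega
    nlinarith
  have h3 : (n : ℝ) ≤ 420 * (2 : ℝ) ^ (n / 210) := by exact_mod_cast h2
  calc (n : ℝ) ^ 6 ≤ (420 * (2 : ℝ) ^ (n / 210)) ^ 6 := pow_le_pow_left₀ (Nat.cast_nonneg _) h3 6
    _ = 420 ^ 6 * (2 : ℝ) ^ (6 * (n / 210)) := by rw [mul_pow, ← pow_mul, mul_comm (n / 210) 6]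
    _ ≤ 420 ^ 6 * (2 : ℝ) ^ ρ := by
        refine mul_le_mul_of_nonneg_left (pow_le_pow_right₀ (by norm_num) h) (by norm_num)

/-- The polynomial `Ψ` of `typeIISq_le_params` (with `d = 1`) is bounded when `D, Λ ≤ n`,
`k^{3a} ≤ 8n³`, `n ≤ k^a`, `n² ≤ k^b`, `n³ k^{3a} ≤ k^{2g}` and `n⁶ ≤ 420⁶ k^ρ`. [folklore] -/
theorem psi_le {C d₀ D Λ q3a qρ qa qb qg n : ℝ} (hd : d₀ = 1) (hC : 0 ≤ C) (hD0 : 0 ≤ D) (hD : D ≤ n)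
    (hΛ1 : 1 ≤ Λ) (hΛ : Λ ≤ n) (hq3a0 : 0 ≤ q3a) (hq3a : q3a ≤ 8 * n ^ 3) (hqρ : 0 < qρ)
    (hρn : n ^ 6 ≤ 420 ^ 6 * qρ) (hqa : n ≤ qa) (hqb : n ^ 2 ≤ qb) (hqg0 : 0 < qg)
    (hqg : n ^ 3 * q3a ≤ qg) :
    (16 * d₀ * C + 20 * d₀ +
        ((32 * d₀ * C * Λ * (2 * D + 2 + Λ) + 64 * d₀ * (1 + D)) +
          (64 * d₀ * Λ * (2 * D + 2 + Λ) + 32 * d₀ * (1 + D)) +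
          (2 * d₀ * Λ * (18 * d₀ * Λ ^ 2 * q3a + 8 * d₀ * C) +
            2 * D * d₀ ^ 2 * Λ + 3 * d₀ ^ 2 * Λ ^ 2) +
          d₀ ^ 2 * (1 + Λ) ^ 2 * (4 + Λ)) / qρ +
        72 * d₀ ^ 2 * D * Λ ^ 2 * q3a / qg +
        32 * d₀ ^ 2 * C * D / qa + 4 * D * d₀ ^ 2 * Λ / qb) ≤ 96 + 48 * C + 825 * 420 ^ 6 * (1 + C) := by
  subst hd
  have hn : 1 ≤ n := hΛ1.trans hΛ
  have hΛ0 : 0 ≤ Λ := by linarith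
  have hqa0 : 0 < qa := by linarith
  have hqb0 : 0 < qb := by nlinarith
  simp only [one_pow, mul_one, one_mul]
  -- the polynomial
  have hP : 32 * C * Λ * (2 * D + 2 + Λ) + 64 * (1 + D) + (64 * Λ * (2 * D + 2 + Λ) + 32 * (1 + D)) +
      (2 * Λ * (18 * Λ ^ 2 * q3a + 8 * C) + 2 * D * Λ + 3 * Λ ^ 2) + (1 + Λ) ^ 2 * (4 + Λ) ≤
      32 * C * n * (2 * n + 2 + n) + 64 * (1 + n) + (64 * n * (2 * n + 2 + n) + 32 * (1 + n)) +
      (2 * n * (18 * n ^ 2 * (8 * n ^ 3) + 8 * C) + 2 * n * n + 3 * n ^ 2) + (1 + n) ^ 2 * (4 + n) := by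
    gcongr
  have hQ : 32 * C * n * (2 * n + 2 + n) + 64 * (1 + n) + (64 * n * (2 * n + 2 + n) + 32 * (1 + n)) +
      (2 * n * (18 * n ^ 2 * (8 * n ^ 3) + 8 * C) + 2 * n * n + 3 * n ^ 2) + (1 + n) ^ 2 * (4 + n) ≤
      (825 + 176 * C) * n ^ 6 := by
    have h1 : n ≤ n ^ 6 := le_self_pow₀ hn (by norm_num)
    have h2 : n ^ 2 ≤ n ^ 6 := pow_le_pow_right₀ hn (by norm_num)
    have h3 : n ^ 3 ≤ n ^ 6 := pow_le_pow_right₀ hn (by norm_num)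
    have h0 : 1 ≤ n ^ 6 := one_le_pow₀ hn
    have hc1 : C * n ≤ C * n ^ 6 := mul_le_mul_of_nonneg_left h1 hC
    have hc2 : C * n ^ 2 ≤ C * n ^ 6 := mul_le_mul_of_nonneg_left h2 hC
    nlinarith
  -- the four groups
  have hG1 : (32 * C * Λ * (2 * D + 2 + Λ) + 64 * (1 + D) + (64 * Λ * (2 * D + 2 + Λ) + 32 * (1 + D)) +
      (2 * Λ * (18 * Λ ^ 2 * q3a + 8 * C) + 2 * D * Λ + 3 * Λ ^ 2) + (1 + Λ) ^ 2 * (4 + Λ)) / qρ ≤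
      825 * 420 ^ 6 * (1 + C) := by
    rw [div_le_iff₀ hqρ]
    have : (825 + 176 * C) * n ^ 6 ≤ 825 * 420 ^ 6 * (1 + C) * qρ := by
      have h1 : (825 + 176 * C) * n ^ 6 ≤ (825 + 176 * C) * (420 ^ 6 * qρ) :=
        mul_le_mul_of_nonneg_left hρn (by positivity)
      nlinarith
    linarith
  have hG2 : 72 * D * Λ ^ 2 * q3a / qg ≤ 72 := by
    rw [div_le_iff₀ hqg0]
    have : D * Λ ^ 2 * q3a ≤ n ^ 3 * q3a := by
      have h1 : D * Λ ^ 2 ≤ n * n ^ 2 := mul_le_mul hD (pow_le_pow_left₀ hΛ0 hΛ 2) (by positivity) (by linarith)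
      have h2 : n * n ^ 2 = n ^ 3 := by ring
      rw [h2] at h1
      exact mul_le_mul_of_nonneg_right h1 hq3a0
    nlinarith
  have hG3 : 32 * C * D / qa ≤ 32 * C := by
    rw [div_le_iff₀ hqa0]
    have : C * D ≤ C * qa := mul_le_mul_of_nonneg_left (hD.trans hqa) hC
    nlinarith
  have hG4 : 4 * D * Λ / qb ≤ 4 := by
    rw [div_le_iff₀ hqb0]
    have : D * Λ ≤ n ^ 2 := by nlinarith
    nlinarith
  linarith

/-- The final combination for a block: from `T ≤ M (A/R + 8√Ψ/P)`, `Ψ ≤ Ψm`, `R⁻¹ ≤ E`,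
`P⁻¹ ≤ 4 Lr E`, `Lr ≥ 1`: `T ≤ (A + 32 √Ψm) M Lr E`. [folklore] -/
theorem block_combine {T M A R P Ψ Ψm Lr E : ℝ} (hT : T ≤ M * (A / R + 8 * Real.sqrt Ψ / P))
    (hA0 : 0 ≤ A) (hM : 0 ≤ M) (hΨ : Ψ ≤ Ψm) (hR : R⁻¹ ≤ E)
    (hP : P⁻¹ ≤ 4 * Lr * E) (hPpos : 0 < P) (hLr : 1 ≤ Lr) (hE : 0 ≤ E) :
    T ≤ (A + 32 * Real.sqrt Ψm) * M * Lr * E := by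
  have h1 : A / R ≤ A * Lr * E := by
    rw [div_eq_mul_inv]
    calc A * R⁻¹ ≤ A * E := mul_le_mul_of_nonneg_left hR hA0
      _ = A * 1 * E := by ring
      _ ≤ A * Lr * E := by gcongr
  have h2 : 8 * Real.sqrt Ψ / P ≤ 32 * Real.sqrt Ψm * Lr * E := by
    rw [div_eq_mul_inv]
    calc 8 * Real.sqrt Ψ * P⁻¹ ≤ 8 * Real.sqrt Ψm * (4 * Lr * E) :=
          mul_le_mul (mul_le_mul_of_nonneg_left (Real.sqrt_le_sqrt hΨ) (by norm_num)) hP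
            (inv_nonneg.2 hPpos.le) (by positivity)
      _ = _ := by ring
  calc T ≤ M * (A / R + 8 * Real.sqrt Ψ / P) := hT
    _ ≤ M * (A * Lr * E + 32 * Real.sqrt Ψm * Lr * E) := mul_le_mul_of_nonneg_left (add_le_add h1 h2) hM
    _ = _ := by ring

/-- `⌊ρ/10⌋ ≥ ρ/10 − 1` in `ℝ`. [folklore] -/
theorem cast_div_ten_ge (ρ : ℕ) : (ρ : ℝ) / 10 - 1 ≤ ((ρ / 10 : ℕ) : ℝ) := by
  have h := Nat.div_add_mod ρ 10
  have h2 := Nat.mod_lt ρ (by norm_num : 0 < 10)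
  have h3 : ((10 * (ρ / 10) + ρ % 10 : ℕ) : ℝ) = ρ := by exact_mod_cast h
  push_cast at h3
  have h4 : ((ρ % 10 : ℕ) : ℝ) ≤ 9 := by exact_mod_cast (by omega : ρ % 10 ≤ 9)
  linarith

/-- `2^{3t/10} ≤ 2 L^{3/10}` when `2^t ≤ 2L`. [folklore] -/
theorem two_rpow_le_of_pow_le {t L : ℕ} (h : 2 ^ t ≤ 2 * L) :
    (2 : ℝ) ^ ((3 : ℝ) / 10 * t) ≤ 2 * (L : ℝ) ^ ((3 : ℝ) / 10) := by
  have h1 : ((2 : ℝ) ^ t : ℝ) ≤ 2 * L := by exact_mod_cast h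
  have e : (2 : ℝ) ^ ((3 : ℝ) / 10 * t) = ((2 : ℝ) ^ t) ^ ((3 : ℝ) / 10) := by
    rw [mul_comm, Real.rpow_mul (by norm_num), Real.rpow_natCast]
  rw [e]
  calc ((2 : ℝ) ^ t) ^ ((3 : ℝ) / 10) ≤ (2 * (L : ℝ)) ^ ((3 : ℝ) / 10) :=
        Real.rpow_le_rpow (by positivity) h1 (by norm_num)
    _ = (2 : ℝ) ^ ((3 : ℝ) / 10) * (L : ℝ) ^ ((3 : ℝ) / 10) := Real.mul_rpow (by norm_num) (Nat.cast_nonneg _)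
    _ ≤ 2 * (L : ℝ) ^ ((3 : ℝ) / 10) := by
        refine mul_le_mul_of_nonneg_right ?_ (by positivity)
        calc (2 : ℝ) ^ ((3 : ℝ) / 10) ≤ (2 : ℝ) ^ (1 : ℝ) :=
              Real.rpow_le_rpow_of_exponent_le (by norm_num) (by norm_num)
          _ = 2 := Real.rpow_one 2

/-! ## The type-II estimate for a dyadic block in base 2 -/

set_option maxHeartbeats 1600000 in
/-- **Mauduit–Rivat's Proposition 2 for a dyadic block, base 2, with MR's §8/(86)–(90) choice of
the parameters** (`ρ = min(⌊5μ/71⌋, ⌊5ν/58⌋)`, `ρ' = min(⌊ρ/10⌋, ⌊(γ(2ρ) − 3t)/10⌋)`,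
`2^{t-1} ≤ μ + 2ρ + 1 < 2^t`, `a = t`, `b = 2t`, `g = 3t`): for `L ≥ 1024`, a block
`M = 2^μ`, `N = 2^ν` with `L/3 + 1 ≤ μ ≤ L − L/3 + 1`, `L ≤ μ + ν ≤ L + 2`, and `λ₀ ≤ L/25`,
`∑_{2^{μ-1} ≤ m < 2^μ} ‖∑_{2^{ν-1} ≤ n < 2^ν} e(ϑmn) B_n F(mn)‖² ≤ K(C) 2^μ 4^ν L^{3/10} 2^{−γ(λ₀)/10}`.
[cite: MauduitRivat2015, Prop. 2, (86)–(90), §8] -/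
theorem typeIISq_base2_block (U : Circle →* unitaryGroup (Fin 1) ℂ) {f : ℕ → Circle} {C : ℝ}
    (hcarry : HasCarryProperty 2 1 C f) {γ : ℝ → ℝ} {c : ℝ} (hc : 10 ≤ c)
    (hfour : HasFourierProperty 2 γ c (umat U f)) (hmono : Monotone γ)
    (h26 : ∀ lam : ℕ, γ lam ≤ lam / 2) (ϑ : ℝ) {B : ℕ → Matrix (Fin 1) (Fin 1) ℂ}
    (hB : ∀ n, ‖B n‖ ≤ 1) {L μ ν : ℕ} (hL : 1024 ≤ L) (hμlo : L / 3 + 1 ≤ μ)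
    (hμhi : μ + L / 3 ≤ L + 1) (hνlo : L ≤ μ + ν) (hνhi : μ + ν ≤ L + 2) {lam₀ : ℝ}
    (hlam₀ : lam₀ ≤ (L : ℝ) / 25) :
    typeIISq ϑ B (umat U f) (2 ^ (μ - 1)) (2 ^ μ) (2 ^ (ν - 1)) (2 ^ ν) ≤
      (2 + 48 * C + 4 * Real.sqrt 2 + 32 * Real.sqrt (96 + 48 * C + 825 * 420 ^ 6 * (1 + C))) *
        ((2 : ℝ) ^ μ * ((2 : ℝ) ^ ν) ^ 2) * (L : ℝ) ^ ((3 : ℝ) / 10) * (2 : ℝ) ^ (-γ lam₀ / 10) := by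
  -- `C ≥ 0`
  have hC0 : 0 ≤ C := by
    have h := hcarry 1 0 0 (by norm_num)
    by_contra hneg
    push Not at hneg
    have hpos : (0 : ℝ) < ((2 : ℕ) : ℝ) ^ (((1 : ℕ) : ℝ) - 1 * ((0 : ℕ) : ℝ)) := by positivity
    have := mul_neg_of_neg_of_pos hneg hpos
    linarith [Nat.cast_nonneg (α := ℝ) (carryViolations 2 f 1 0 0).card]
  -- the parameters
  obtain ⟨ρ, hρμ, hρν, hρor⟩ : ∃ ρ : ℕ, ρ ≤ 5 * μ / 71 ∧ ρ ≤ 5 * ν / 58 ∧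
      (ρ = 5 * μ / 71 ∨ ρ = 5 * ν / 58) :=
    ⟨min (5 * μ / 71) (5 * ν / 58), min_le_left _ _, min_le_right _ _, min_choice _ _⟩
  obtain ⟨t, ht1, ht2⟩ : ∃ t : ℕ, μ + 2 * ρ + 1 < 2 ^ t ∧ 2 ^ t ≤ 2 * (μ + 2 * ρ + 1) := by
    refine ⟨Nat.log 2 (μ + 2 * ρ + 1) + 1, Nat.lt_pow_succ_log_self (by norm_num) _, ?_⟩
    rw [pow_succ]
    have := Nat.pow_log_le_self 2 (show μ + 2 * ρ + 1 ≠ 0 by omega)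
    linarith
  have hn₂L : μ + 2 * ρ + 1 ≤ L := by omega
  have htL : 64 * t ≤ L := sixtyfour_mul_le_of_pow_le ht2 hn₂L hL
  have ht1' : 1 ≤ t := by
    rcases Nat.eq_zero_or_pos t with h | h
    · rw [h, pow_zero] at ht1; omega
    · exact h
  have hρ1 : 1 ≤ ρ := by rcases hρor with h | h <;> omega
  have hμt : μ + 10 * t ≤ 32 * ρ := by rcases hρor with h | h <;> omega
  have htρ : t ≤ ρ := by omega
  have hLρ : L ≤ 50 * ρ := by rcases hρor with h | h <;> omega
  set Γ : ℝ := γ ((2 * ρ : ℕ) : ℝ) with hΓ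
  obtain ⟨ρ', hρ'1, hρ'2, hρ'or⟩ : ∃ ρ' : ℕ, ρ' ≤ ρ / 10 ∧ ρ' ≤ ⌊(Γ - 3 * t) / 10⌋₊ ∧
      (ρ' = ρ / 10 ∨ ρ' = ⌊(Γ - 3 * t) / 10⌋₊) :=
    ⟨min (ρ / 10) ⌊(Γ - 3 * t) / 10⌋₊, min_le_left _ _, min_le_right _ _, min_choice _ _⟩
  obtain ⟨μ₁, hμ₁⟩ : ∃ μ₁, μ₁ + 2 * ρ = μ := ⟨μ - 2 * ρ, by omega⟩
  obtain ⟨μ₀, hμ₀⟩ : ∃ μ₀, μ₀ + 2 * ρ' = μ₁ := ⟨μ₁ - 2 * ρ', by omega⟩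
  obtain ⟨lam, hlam⟩ : ∃ lam, lam + 2 * ρ' + 2 * t = 3 * ρ := ⟨3 * ρ - 2 * ρ' - 2 * t, by omega⟩
  have hρ'ρ : ρ' ≤ ρ := by omega
  have hμc : 13 * ρ + 12 * ρ' ≤ μ := by omega
  have hνc : 11 * ρ + 6 * ρ' ≤ ν := by omega
  have hab : t + 1 ≤ ρ + 2 * t := by omega
  have hlam2 : 2 * ρ' ≤ lam := by omega
  have hX : 2 * ρ ≤ lam + (4 * ρ' + t) := by omega
  have hn34 : 6 * ((μ + 2 * ρ + 1) / 210) ≤ ρ := by omega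
  have hc0 : 0 ≤ c := by linarith
  have hc' : (μ₀ : ℝ) ≤ c * ((lam + (4 * ρ' + t) : ℕ) : ℝ) := by
    have h1 : ((μ₀ : ℕ) : ℝ) ≤ 10 * ((lam + (4 * ρ' + t) : ℕ) : ℝ) := by
      exact_mod_cast (show μ₀ ≤ 10 * (lam + (4 * ρ' + t)) by omega)
    have h2 : (0 : ℝ) ≤ ((lam + (4 * ρ' + t) : ℕ) : ℝ) := Nat.cast_nonneg _
    nlinarith
  -- real facts
  have hΓρ : Γ ≤ ρ := by
    have h := h26 (2 * ρ)
    rw [hΓ]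
    push_cast at h ⊢
    linarith
  have hlam₀ρ : lam₀ ≤ ((2 * ρ : ℕ) : ℝ) := by
    have : (L : ℝ) ≤ 50 * ρ := by exact_mod_cast hLρ
    push_cast; linarith
  have hγ₀Γ : γ lam₀ ≤ Γ := hmono hlam₀ρ
  have hL1 : (1 : ℝ) ≤ L := by exact_mod_cast (show 1 ≤ L by omega)
  set Lr : ℝ := (L : ℝ) ^ ((3 : ℝ) / 10) with hLr
  have hLr1 : 1 ≤ Lr := Real.one_le_rpow hL1 (by norm_num)
  set E : ℝ := (2 : ℝ) ^ (-γ lam₀ / 10) with hE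
  have hE0 : 0 < E := Real.rpow_pos_of_pos (by norm_num) _
  have hEΓ : (2 : ℝ) ^ (-Γ / 10) ≤ E :=
    Real.rpow_le_rpow_of_exponent_le (by norm_num) (by linarith)
  have h2t : (2 : ℝ) ^ ((3 : ℝ) / 10 * t) ≤ 2 * Lr :=
    two_rpow_le_of_pow_le (le_trans ht2 (by omega))
  have hM0 : (0 : ℝ) ≤ ((2 : ℕ) : ℝ) ^ μ * (((2 : ℕ) : ℝ) ^ ν) ^ 2 := by positivity
  have hK4 : (4 : ℝ) ≤ 2 + 48 * C + 4 * Real.sqrt 2 + 32 * Real.sqrt (96 + 48 * C + 825 * 420 ^ 6 * (1 + C)) := by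
    have h1 : (1 : ℝ) ≤ Real.sqrt 2 := by
      rw [show (1 : ℝ) = Real.sqrt 1 from Real.sqrt_one.symm]
      exact Real.sqrt_le_sqrt (by norm_num)
    have h2 : (0 : ℝ) ≤ Real.sqrt (96 + 48 * C + 825 * 420 ^ 6 * (1 + C)) := Real.sqrt_nonneg _
    nlinarith
  by_cases hcase : (3 * t + 10 : ℝ) ≤ Γ
  · -- the main case: MR's Proposition 2 with the parameters
    have hfl : ((ρ' : ℕ) : ℝ) ≤ (Γ - 3 * t) / 10 := by
      have h0 : 0 ≤ (Γ - 3 * t) / 10 := by linarith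
      calc (ρ' : ℝ) ≤ (⌊(Γ - 3 * t) / 10⌋₊ : ℝ) := by exact_mod_cast hρ'2
        _ ≤ _ := Nat.floor_le h0
    have hγ' : ((10 * ρ' + 3 * t : ℕ) : ℝ) ≤ γ ((lam + (4 * ρ' + t) : ℕ) : ℝ) := by
      have h1 : ((10 * ρ' + 3 * t : ℕ) : ℝ) ≤ Γ := by push_cast; linarith
      have h2 : Γ ≤ γ ((lam + (4 * ρ' + t) : ℕ) : ℝ) := hmono (by exact_mod_cast hX)
      linarith
    have hT := typeIISq_le_params (k := 2) U (by norm_num) hcarry hfour ϑ hB hρ1 hρ'ρ hμc hνc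
      (a := t) (b := 2 * t) (g := 3 * t) hab hμ₁ hμ₀ (by omega : lam + 2 * ρ' + 2 * t = 3 * ρ)
      hlam2 hc' hγ'
    -- the lower bound for `ρ'`
    have hρ'lo : (Γ - 3 * t) / 10 - 1 ≤ ρ' := by
      rcases hρ'or with h | h
      · rw [h]
        have := cast_div_ten_ge ρ
        linarith
      · rw [h]
        have := Nat.lt_floor_add_one ((Γ - 3 * t) / 10)
        linarith
    -- `Ψ ≤ Ψmax`
    have hn1 : (1 : ℝ) ≤ ((μ + 2 * ρ + 1 : ℕ) : ℝ) := by exact_mod_cast (show 1 ≤ μ + 2 * ρ + 1 by omega)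
    have hD : (((2 ^ (μ + 2 * ρ)).divisors.card : ℕ) : ℝ) ≤ ((μ + 2 * ρ + 1 : ℕ) : ℝ) := by
      rw [Nat.divisors_prime_pow Nat.prime_two, Finset.card_map, Finset.card_range]
    have hΛ1 : (1 : ℝ) ≤ 1 + Real.log (((2 : ℕ) : ℝ) ^ (μ + 2 * ρ)) := by
      have : (0 : ℝ) ≤ Real.log (((2 : ℕ) : ℝ) ^ (μ + 2 * ρ)) := by
        rw [← Nat.cast_pow]; exact Real.log_natCast_nonneg _
      linarith
    have hΛn : 1 + Real.log (((2 : ℕ) : ℝ) ^ (μ + 2 * ρ)) ≤ ((μ + 2 * ρ + 1 : ℕ) : ℝ) := by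
      rw [Real.log_pow]
      have := Real.log_two_lt_d9
      push_cast
      nlinarith [Nat.cast_nonneg (α := ℝ) (μ + 2 * ρ)]
    have hq3a : ((2 : ℕ) : ℝ) ^ (3 * t) ≤ 8 * ((μ + 2 * ρ + 1 : ℕ) : ℝ) ^ 3 := by
      have h1 : ((2 ^ t : ℕ) : ℝ) ≤ 2 * ((μ + 2 * ρ + 1 : ℕ) : ℝ) := by exact_mod_cast ht2
      have h2 : (((2 : ℕ) : ℝ) ^ (3 * t)) = (((2 ^ t : ℕ) : ℝ)) ^ 3 := by push_cast; ring
      rw [h2]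
      calc (((2 ^ t : ℕ) : ℝ)) ^ 3 ≤ (2 * ((μ + 2 * ρ + 1 : ℕ) : ℝ)) ^ 3 :=
            pow_le_pow_left₀ (Nat.cast_nonneg _) h1 3
        _ = _ := by ring
    have hqa : ((μ + 2 * ρ + 1 : ℕ) : ℝ) ≤ ((2 : ℕ) : ℝ) ^ t := by
      have : ((μ + 2 * ρ + 1 : ℕ) : ℝ) ≤ ((2 ^ t : ℕ) : ℝ) := by exact_mod_cast ht1.le
      simpa using this
    have hqb : ((μ + 2 * ρ + 1 : ℕ) : ℝ) ^ 2 ≤ ((2 : ℕ) : ℝ) ^ (2 * t) := by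
      rw [pow_mul']
      exact pow_le_pow_left₀ (Nat.cast_nonneg _) hqa 2
    have hqg : ((μ + 2 * ρ + 1 : ℕ) : ℝ) ^ 3 * ((2 : ℕ) : ℝ) ^ (3 * t) ≤ ((2 : ℕ) : ℝ) ^ (2 * (3 * t)) := by
      have h1 : ((μ + 2 * ρ + 1 : ℕ) : ℝ) ^ 3 ≤ ((2 : ℕ) : ℝ) ^ (3 * t) := by
        rw [pow_mul']
        exact pow_le_pow_left₀ (Nat.cast_nonneg _) hqa 3
      calc ((μ + 2 * ρ + 1 : ℕ) : ℝ) ^ 3 * ((2 : ℕ) : ℝ) ^ (3 * t)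
          ≤ ((2 : ℕ) : ℝ) ^ (3 * t) * ((2 : ℕ) : ℝ) ^ (3 * t) := mul_le_mul_of_nonneg_right h1 (by positivity)
        _ = _ := by rw [← pow_add]; congr 1; ring
    have hρn : ((μ + 2 * ρ + 1 : ℕ) : ℝ) ^ 6 ≤ 420 ^ 6 * ((2 : ℕ) : ℝ) ^ ρ := by
      have := pow_six_le hn34
      simpa using this
    have hΨ := psi_le (C := C) (d₀ := (Fintype.card (Fin 1) : ℝ)) (by simp) hC0 (Nat.cast_nonneg _) hD hΛ1
      hΛn (by positivity) hq3a (by positivity) hρn hqa hqb (by positivity) hqg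
    -- `R⁻¹ ≤ E`, `P⁻¹ ≤ 4 Lr E`
    have hR : ((((2 : ℕ) : ℝ)) ^ ρ)⁻¹ ≤ E := by
      rw [Nat.cast_ofNat, ← Real.rpow_natCast, ← Real.rpow_neg (by norm_num)]
      exact Real.rpow_le_rpow_of_exponent_le (by norm_num) (by linarith)
    have hP : ((((2 : ℕ) : ℝ)) ^ ρ')⁻¹ ≤ 4 * Lr * E := by
      rw [Nat.cast_ofNat, ← Real.rpow_natCast, ← Real.rpow_neg (by norm_num)]
      calc (2 : ℝ) ^ (-(ρ' : ℝ)) ≤ (2 : ℝ) ^ (1 + (3 : ℝ) / 10 * t + -Γ / 10) :=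
            Real.rpow_le_rpow_of_exponent_le (by norm_num) (by linarith)
        _ = 2 * (2 : ℝ) ^ ((3 : ℝ) / 10 * t) * (2 : ℝ) ^ (-Γ / 10) := by
            rw [Real.rpow_add (by norm_num), Real.rpow_add (by norm_num), Real.rpow_one]
        _ ≤ 2 * (2 * Lr) * E :=
            mul_le_mul (mul_le_mul_of_nonneg_left h2t (by norm_num)) hEΓ (by positivity) (by positivity)
        _ = 4 * Lr * E := by ring
    have hA0 : (0 : ℝ) ≤ 2 + 24 * Real.sqrt (Fintype.card (Fin 1) : ℝ) * ((2 : ℕ) * C) +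
        4 * Real.sqrt (2 * (Fintype.card (Fin 1) : ℝ)) := by positivity
    have hfin := block_combine hT hA0 hM0 hΨ hR hP (by positivity) hLr1 hE0.le
    refine hfin.trans (le_of_eq ?_)
    simp only [Fintype.card_fin, Nat.cast_one, Real.sqrt_one, Nat.cast_ofNat]
    ring
  · -- the trivial bound suffices
    push Not at hcase
    have hT := typeIISq_le_trivial U f ϑ hB (2 ^ (μ - 1)) (2 ^ μ) (2 ^ (ν - 1)) (2 ^ ν)
    have hM' : ((2 ^ μ - 2 ^ (μ - 1) : ℕ) : ℝ) ≤ (2 : ℝ) ^ μ := by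
      have : ((2 ^ μ - 2 ^ (μ - 1) : ℕ) : ℝ) ≤ ((2 ^ μ : ℕ) : ℝ) := by exact_mod_cast Nat.sub_le _ _
      simpa using this
    have hN' : ((2 ^ ν - 2 ^ (ν - 1) : ℕ) : ℝ) ≤ (2 : ℝ) ^ ν := by
      have : ((2 ^ ν - 2 ^ (ν - 1) : ℕ) : ℝ) ≤ ((2 ^ ν : ℕ) : ℝ) := by exact_mod_cast Nat.sub_le _ _
      simpa using this
    have hT' : typeIISq ϑ B (umat U f) (2 ^ (μ - 1)) (2 ^ μ) (2 ^ (ν - 1)) (2 ^ ν) ≤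
        (2 : ℝ) ^ μ * ((2 : ℝ) ^ ν) ^ 2 := by
      refine hT.trans ?_
      simp only [Fintype.card_fin, Nat.cast_one, one_mul]
      exact mul_le_mul hM' (pow_le_pow_left₀ (Nat.cast_nonneg _) hN' 2) (by positivity) (by positivity)
    -- `Lr E ≥ 1/4`
    have hLE : 1 ≤ 4 * Lr * E := by
      have h1 : (2 : ℝ) ^ (-(3 * (t : ℝ) + 10) / 10) ≤ E :=
        Real.rpow_le_rpow_of_exponent_le (by norm_num) (by linarith)
      have h2 : (2 : ℝ) ^ (-(3 * (t : ℝ) + 10) / 10) * (2 * (2 : ℝ) ^ ((3 : ℝ) / 10 * t)) = 1 := by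
        rw [show (2 : ℝ) * (2 : ℝ) ^ ((3 : ℝ) / 10 * t) = (2 : ℝ) ^ (1 + (3 : ℝ) / 10 * t) by
          rw [Real.rpow_add (by norm_num), Real.rpow_one], ← Real.rpow_add (by norm_num)]
        rw [show -(3 * (t : ℝ) + 10) / 10 + (1 + 3 / 10 * t) = 0 by ring, Real.rpow_zero]
      have h3 : 0 < (2 : ℝ) ^ (-(3 * (t : ℝ) + 10) / 10) := Real.rpow_pos_of_pos (by norm_num) _
      calc (1 : ℝ) = (2 : ℝ) ^ (-(3 * (t : ℝ) + 10) / 10) * (2 * (2 : ℝ) ^ ((3 : ℝ) / 10 * t)) := h2.symm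
        _ ≤ E * (2 * (2 * Lr)) := mul_le_mul h1 (by linarith) (by positivity) hE0.le
        _ = 4 * Lr * E := by ring
    calc typeIISq ϑ B (umat U f) (2 ^ (μ - 1)) (2 ^ μ) (2 ^ (ν - 1)) (2 ^ ν)
        ≤ (2 : ℝ) ^ μ * ((2 : ℝ) ^ ν) ^ 2 * 1 := by rw [mul_one]; exact hT'
      _ ≤ (2 : ℝ) ^ μ * ((2 : ℝ) ^ ν) ^ 2 * (4 * Lr * E) := by gcongr
      _ ≤ (2 : ℝ) ^ μ * ((2 : ℝ) ^ ν) ^ 2 *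
          ((2 + 48 * C + 4 * Real.sqrt 2 + 32 * Real.sqrt (96 + 48 * C + 825 * 420 ^ 6 * (1 + C))) * Lr * E) := by
          gcongr
      _ = _ := by ring


/-! ## The type-I estimate for a dyadic block in base 2 -/

/-- The last factor of `typeI_sum_le` with `ρ₁ = ⌊γ(λ)⌋`: `2^{-G}√(2^{ρ₁}) + 2√(C 2^{-ρ₁})
≤ (1 + 2√2 √C) 2^{-G/2}`. [folklore] -/
theorem typeI_third_factor_le {C G : ℝ} {ρ₁ : ℕ} (hC : 0 ≤ C) (hρ₁ : (ρ₁ : ℝ) ≤ G) (hρ₁' : G < ρ₁ + 1) :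
    (2 : ℝ) ^ (-G) * Real.sqrt ((2 ^ ρ₁ : ℕ) : ℝ) + (1 + 1) * Real.sqrt (C * (2 : ℝ) ^ (-(1 * (ρ₁ : ℝ)))) ≤
      (1 + 2 * Real.sqrt 2 * Real.sqrt C) * (2 : ℝ) ^ (-G / 2) := by
  have h2 : (0 : ℝ) < 2 := by norm_num
  have e1 : Real.sqrt ((2 ^ ρ₁ : ℕ) : ℝ) = (2 : ℝ) ^ ((ρ₁ : ℝ) / 2) := by
    rw [Real.sqrt_eq_rpow, Nat.cast_pow, Nat.cast_ofNat, ← Real.rpow_natCast, ← Real.rpow_mul h2.le]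
    congr 1; ring
  have e2 : Real.sqrt ((2 : ℝ) ^ (-(1 * (ρ₁ : ℝ)))) = (2 : ℝ) ^ (-(ρ₁ : ℝ) / 2) := by
    rw [Real.sqrt_eq_rpow, ← Real.rpow_mul h2.le]
    congr 1; ring
  have t1 : (2 : ℝ) ^ (-G) * Real.sqrt ((2 ^ ρ₁ : ℕ) : ℝ) ≤ (2 : ℝ) ^ (-G / 2) := by
    rw [e1, ← Real.rpow_add h2]
    exact Real.rpow_le_rpow_of_exponent_le (by norm_num) (by linarith)
  have t2 : Real.sqrt (C * (2 : ℝ) ^ (-(1 * (ρ₁ : ℝ)))) ≤ Real.sqrt C * (Real.sqrt 2 * (2 : ℝ) ^ (-G / 2)) := by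
    rw [Real.sqrt_mul hC, e2]
    refine mul_le_mul_of_nonneg_left ?_ (Real.sqrt_nonneg _)
    rw [Real.sqrt_eq_rpow, ← Real.rpow_add h2]
    exact Real.rpow_le_rpow_of_exponent_le (by norm_num) (by linarith)
  have h0 : 0 ≤ Real.sqrt C * (Real.sqrt 2 * (2 : ℝ) ^ (-G / 2)) := by positivity
  nlinarith [t1, t2, h0, Real.sqrt_nonneg C, Real.sqrt_nonneg 2,
    Real.rpow_nonneg h2.le (-G / 2)]

set_option maxHeartbeats 800000 in
/-- **Mauduit–Rivat's Proposition 1 for a dyadic block, base 2** (`κ = 2j + 2`, `λ = L − 2j − 1`,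
`ρ₁ = ⌊γ(λ)⌋`, `K = 2^{L+1} > x`): for `x ≥ 2^6`, `j ≤ L/3` (`L = ⌊log₂ x⌋`), `λ₀ ≤ L/25`,
`γ(λ₀) ≥ 0`:
`∑_{2^j ≤ a < 2^{j+1}} |∑_{x/2 < ℓ ≤ x, a ∣ ℓ} e(ϑℓ) f(ℓ)| ≤ 8(1 + 2√2√C) x Λ² √Λ 2^{−γ(λ₀)/2}`,
`Λ = 1 + log 2x`. [cite: MauduitRivat2015, Prop. 1, §5] -/
theorem blockI_base2_le (U : Circle →* unitaryGroup (Fin 1) ℂ)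
    (hU : ∀ z : Circle, (U z : Matrix (Fin 1) (Fin 1) ℂ) = (z : ℂ) • 1) {f : ℕ → Circle} {C : ℝ}
    (hcarry : HasCarryProperty 2 1 C f) {γ : ℝ → ℝ} {c : ℝ} (hc : 10 ≤ c)
    (hfour : HasFourierProperty 2 γ c (umat U f)) (hmono : Monotone γ)
    (h26 : ∀ lam : ℕ, γ lam ≤ lam / 2) (ϑ : ℝ) {x j : ℕ} (hx : 2 ^ 6 ≤ x)
    (hj : j ≤ Nat.log 2 x / 3) {lam₀ : ℝ} (hlam₀ : lam₀ ≤ (Nat.log 2 x : ℝ) / 25) (hγ₀ : 0 ≤ γ lam₀) :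
    blockI 2 x j (fun n => (𝐞 (ϑ * n) : ℂ) * ((f n : Circle) : ℂ)) ≤
      8 * (1 + 2 * Real.sqrt 2 * Real.sqrt C) * x * ((1 + Real.log (2 * x)) ^ 2 *
        Real.sqrt (1 + Real.log (2 * x))) * (2 : ℝ) ^ (-γ lam₀ / 2) := by
  -- `C ≥ 0`
  have hC0 : 0 ≤ C := by
    have h := hcarry 1 0 0 (by norm_num)
    by_contra hneg
    push Not at hneg
    have hpos : (0 : ℝ) < ((2 : ℕ) : ℝ) ^ (((1 : ℕ) : ℝ) - 1 * ((0 : ℕ) : ℝ)) := by positivity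
    have := mul_neg_of_neg_of_pos hneg hpos
    linarith [Nat.cast_nonneg (α := ℝ) (carryViolations 2 f 1 0 0).card]
  set L := Nat.log 2 x with hL
  have hL6 : 6 ≤ L := by rw [hL]; exact Nat.le_log_of_pow_le (by norm_num) hx
  have hx0 : x ≠ 0 := by intro h; rw [h] at hx; norm_num at hx
  have hxL : 2 ^ L ≤ x := by rw [hL]; exact Nat.pow_log_le_self 2 hx0
  have hxL' : x < 2 ^ (L + 1) := by rw [hL]; exact Nat.lt_pow_succ_log_self (by norm_num) x
  have hjL : j ≤ L := le_trans hj (Nat.div_le_self _ _)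
  -- parameters
  obtain ⟨lam, hlam⟩ : ∃ lam, lam + (2 * j + 2) = L + 1 := ⟨L - 2 * j - 1, by omega⟩
  have hlam1 : 1 ≤ lam := by omega
  have hlamlo : L ≤ 25 * lam := by omega
  have hlam₀' : lam₀ ≤ (lam : ℝ) := by
    have : (L : ℝ) ≤ 25 * lam := by exact_mod_cast hlamlo
    linarith
  have hγlam0 : 0 ≤ γ lam := le_trans hγ₀ (hmono hlam₀')
  set ρ₁ := ⌊γ lam⌋₊ with hρ₁
  have hρ₁le : (ρ₁ : ℝ) ≤ γ lam := Nat.floor_le hγlam0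
  have hρ₁gt : γ lam < ρ₁ + 1 := Nat.lt_floor_add_one _
  have hρ₁lam : ρ₁ < lam := by
    have h1 : (ρ₁ : ℝ) < lam := by
      have := h26 lam
      have : (1 : ℝ) ≤ lam := by exact_mod_cast hlam1
      linarith
    exact_mod_cast h1
  have hκc : ((2 * j + 2 : ℕ) : ℝ) ≤ c * lam := by
    have h1 : ((2 * j + 2 : ℕ) : ℝ) ≤ 10 * (lam : ℝ) := by
      exact_mod_cast (show 2 * j + 2 ≤ 10 * lam by omega)
    have : (0 : ℝ) ≤ lam := Nat.cast_nonneg _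
    nlinarith
  have hM : 2 ^ (j + 1) * 2 ^ (j + 1) ≤ 2 ^ (2 * j + 2) := by
    rw [← pow_add]; exact Nat.pow_le_pow_right (by norm_num) (by omega)
  have hMs : Ico (2 ^ j) (2 ^ (j + 1)) ⊆ Icc 1 (2 ^ (j + 1)) := by
    intro a ha
    rw [mem_Ico] at ha
    rw [mem_Icc]
    exact ⟨Nat.one_le_two_pow.trans ha.1, ha.2.le⟩
  have hK : 2 * j + 2 + lam = L + 1 := by omega
  have hB : x < 2 ^ (2 * j + 2 + lam) := by rw [hK]; exact hxL'
  have h := typeI_sum_le U (by norm_num) hcarry hfour hκc hρ₁lam hM hMs (A := x / 2) hB ϑ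
  rw [← blockI_eq_sum_norm hU f ϑ (by norm_num) x j, hK] at h
  have hs1 : Real.sqrt (Fintype.card (Fin 1) : ℝ) = 1 := by simp
  rw [hs1] at h
  simp only [Nat.cast_ofNat] at h
  -- the factors
  have hxR : (64 : ℝ) ≤ x := by exact_mod_cast (le_trans (by norm_num : 64 ≤ 2 ^ 6) hx)
  set Λx : ℝ := 1 + Real.log (2 * x) with hΛx
  have hlog2x : 0 ≤ Real.log (2 * (x : ℝ)) := Real.log_nonneg (by linarith)
  have hΛx1 : 1 ≤ Λx := by rw [hΛx]; linarith
  have h2L : ((2 ^ (L + 1) : ℕ) : ℝ) ≤ 2 * x := by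
    have : ((2 ^ (L + 1) : ℕ) : ℝ) ≤ ((2 * x : ℕ) : ℝ) := by
      exact_mod_cast (by rw [pow_succ]; omega : 2 ^ (L + 1) ≤ 2 * x)
    push_cast at this ⊢
    exact this
  have hF1 : 2 * ((x - x / 2 : ℕ) : ℝ) + ((2 ^ (L + 1) : ℕ) : ℝ) * (1 + Real.log ((2 ^ (L + 1) : ℕ) : ℝ)) ≤
      4 * x * Λx := by
    have h1 : ((x - x / 2 : ℕ) : ℝ) ≤ x := by exact_mod_cast Nat.sub_le _ _
    have h2 : 1 + Real.log ((2 ^ (L + 1) : ℕ) : ℝ) ≤ Λx := by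
      rw [hΛx]
      have := Real.log_le_log (by positivity) h2L
      linarith
    have h3 : 0 ≤ 1 + Real.log ((2 ^ (L + 1) : ℕ) : ℝ) := by
      have := Real.log_natCast_nonneg (2 ^ (L + 1)); linarith
    have h4 : ((2 ^ (L + 1) : ℕ) : ℝ) * (1 + Real.log ((2 ^ (L + 1) : ℕ) : ℝ)) ≤ (2 * x) * Λx :=
      mul_le_mul h2L h2 h3 (by positivity)
    nlinarith
  have hM2x : ((2 ^ (j + 1) : ℕ) : ℝ) ≤ 2 * x := by
    have : ((2 ^ (j + 1) : ℕ) : ℝ) ≤ ((2 ^ (L + 1) : ℕ) : ℝ) := by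
      exact_mod_cast Nat.pow_le_pow_right (by norm_num) (by omega)
    linarith
  have hlM : 1 + Real.log ((2 ^ (j + 1) : ℕ) : ℝ) ≤ Λx := by
    rw [hΛx]
    have := Real.log_le_log (by positivity) hM2x
    linarith
  have hlM0 : 0 ≤ 1 + Real.log ((2 ^ (j + 1) : ℕ) : ℝ) := by
    have := Real.log_natCast_nonneg (2 ^ (j + 1)); linarith
  have hT3 := typeI_third_factor_le hC0 hρ₁le hρ₁gt
  have hT3' : (2 : ℝ) ^ (-γ ↑lam) * Real.sqrt ((2 ^ ρ₁ : ℕ) : ℝ) +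
      (1 + 1) * Real.sqrt (C * (2 : ℝ) ^ (-(1 * (ρ₁ : ℝ)))) ≤
      (1 + 2 * Real.sqrt 2 * Real.sqrt C) * (2 : ℝ) ^ (-γ lam₀ / 2) := by
    refine hT3.trans (mul_le_mul_of_nonneg_left ?_ (by positivity))
    exact Real.rpow_le_rpow_of_exponent_le (by norm_num) (by linarith [hmono hlam₀'])
  have hT30 : 0 ≤ (2 : ℝ) ^ (-γ ↑lam) * Real.sqrt ((2 ^ ρ₁ : ℕ) : ℝ) +
      (1 + 1) * Real.sqrt (C * (2 : ℝ) ^ (-(1 * (ρ₁ : ℝ)))) := by positivity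
  have hrest : 2 * 1 * (1 + Real.log ((2 ^ (j + 1) : ℕ) : ℝ)) * Real.sqrt (1 + Real.log ((2 ^ (j + 1) : ℕ) : ℝ)) *
      ((2 : ℝ) ^ (-γ ↑lam) * Real.sqrt ((2 ^ ρ₁ : ℕ) : ℝ) +
        (1 + 1) * Real.sqrt (C * (2 : ℝ) ^ (-(1 * (ρ₁ : ℝ))))) ≤
      2 * 1 * Λx * Real.sqrt Λx * ((1 + 2 * Real.sqrt 2 * Real.sqrt C) * (2 : ℝ) ^ (-γ lam₀ / 2)) := by
    refine mul_le_mul (mul_le_mul (mul_le_mul_of_nonneg_left hlM (by norm_num)) (Real.sqrt_le_sqrt hlM)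
      (Real.sqrt_nonneg _) (by positivity)) hT3' hT30 (by positivity)
  have hrest0 : 0 ≤ 2 * 1 * (1 + Real.log ((2 ^ (j + 1) : ℕ) : ℝ)) * Real.sqrt (1 + Real.log ((2 ^ (j + 1) : ℕ) : ℝ)) *
      ((2 : ℝ) ^ (-γ ↑lam) * Real.sqrt ((2 ^ ρ₁ : ℕ) : ℝ) +
        (1 + 1) * Real.sqrt (C * (2 : ℝ) ^ (-(1 * (ρ₁ : ℝ))))) := by positivity
  refine h.trans ((mul_le_mul hF1 hrest hrest0 (by positivity)).trans (le_of_eq ?_))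
  ring


/-! ## The hyperbolic pieces `x/2 < n ≤ x` and the proof of Theorem 2 in base 2 -/

section Pieces

open Literature.NumberTheory.LFunctions.MoebiusWalshVaughan (typeIICoeffB typeIICoeffB_apply
  abs_typeIICoeffB_le)
open Literature.NumberTheory.LFunctions.MRVaughan (blockII_le_of_boxII card_sepRange_le
  norm_sum_moebius_smul_le_blocks hypCut_eq_zero_of_lt)
open scoped ArithmeticFunction.Moebius

variable {U : Circle →* unitaryGroup (Fin 1) ℂ}

/-- Far type-II blocks vanish: if `x < q^j (u + 1)` then `blockII q x j β_u g = 0`. [folklore] -/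
theorem blockII_typeIICoeffB_eq_zero {E : Type*} [NormedAddCommGroup E] [NormedSpace ℝ E]
    {q x j u : ℕ} (h : x < q ^ j * (u + 1)) (g : ℕ → E) :
    blockII q x j (typeIICoeffB u) g = 0 := by
  unfold blockII
  refine sum_eq_zero fun k hk => ?_
  rw [mem_Ico] at hk
  have h0 : ∑ ℓ ∈ Ioc 0 x, typeIICoeffB u ℓ • hypCut q x g (k * ℓ) = 0 := by
    refine sum_eq_zero fun ℓ _ => ?_
    by_cases hℓu : ℓ ≤ u
    · rw [typeIICoeffB_apply, if_pos hℓu, zero_smul]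
    · rw [hypCut_eq_zero_of_lt g ?_, smul_zero]
      calc x < q ^ j * (u + 1) := h
        _ ≤ k * ℓ := Nat.mul_le_mul hk.1 (by omega)
  rw [h0, norm_zero]
  norm_num

/-- The blocks of `sepRange 2 x j` for `j ≤ L = ⌊log₂ x⌋`: `i + j ≤ L ≤ i + j + 2`. [folklore] -/
theorem mem_sepRange_bounds {x j i : ℕ} (hx : x ≠ 0) (hi : i ∈ sepRange 2 x j) (hj : j ≤ Nat.log 2 x) :
    i + j ≤ Nat.log 2 x ∧ Nat.log 2 x ≤ i + j + 2 := by
  unfold sepRange at hi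
  rw [mem_Icc] at hi
  obtain ⟨h1, h2⟩ := hi
  have hxL : 2 ^ Nat.log 2 x ≤ x := Nat.pow_log_le_self 2 hx
  constructor
  · rcases Nat.eq_zero_or_pos (x / 2 ^ j) with h0 | hpos
    · rw [h0, Nat.log_zero_right] at h2
      omega
    · have h3 : 2 ^ i ≤ x / 2 ^ j := le_trans (Nat.pow_le_pow_right (by norm_num) h2)
        (Nat.pow_log_le_self 2 hpos.ne')
      have h4 : 2 ^ (i + j) ≤ x := by
        rw [pow_add]
        exact (Nat.le_div_iff_mul_le (by positivity)).1 h3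
      exact Nat.le_log_of_pow_le (by norm_num) h4
  · have h3 : 2 ^ (Nat.log 2 x - j - 2) ≤ x / 2 ^ (j + 2) + 1 := by
      by_cases hjL : j + 2 ≤ Nat.log 2 x
      · have : 2 ^ (Nat.log 2 x - j - 2) ≤ x / 2 ^ (j + 2) := by
          rw [Nat.le_div_iff_mul_le (by positivity), ← pow_add]
          calc 2 ^ (Nat.log 2 x - j - 2 + (j + 2)) = 2 ^ Nat.log 2 x := by congr 1; omega
            _ ≤ x := hxL
        omega
      · have : Nat.log 2 x - j - 2 = 0 := by omega
        rw [this, pow_zero]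
        exact Nat.le_add_left _ _
    have h4 := Nat.le_log_of_pow_le (by norm_num : 1 < 2) h3
    omega

/-- The weight of the Vaughan-type reduction: `√(2^{j+1}(1 + log 2^{j+1})³) ≤ √(2^{j+1}) Λ √Λ`
for `2^{j+1} ≤ 2x`, `Λ = 1 + log 2x`. [folklore] -/
theorem vaughanWeight_le {x j : ℕ} (hx : 0 < x) (hj : 2 ^ (j + 1) ≤ 2 * x) :
    Real.sqrt ((2 : ℝ) ^ (j + 1) * (1 + Real.log ((2 : ℝ) ^ (j + 1))) ^ 3) ≤
      Real.sqrt ((2 : ℝ) ^ (j + 1)) * ((1 + Real.log (2 * x)) * Real.sqrt (1 + Real.log (2 * x))) := by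
  have hxR : (0 : ℝ) < x := by exact_mod_cast hx
  have h1 : (2 : ℝ) ^ (j + 1) ≤ 2 * x := by exact_mod_cast hj
  have hl0 : 0 ≤ 1 + Real.log ((2 : ℝ) ^ (j + 1)) := by
    have : 0 ≤ Real.log ((2 : ℝ) ^ (j + 1)) := by
      rw [← Nat.cast_ofNat, ← Nat.cast_pow]; exact Real.log_natCast_nonneg _
    linarith
  have hl : 1 + Real.log ((2 : ℝ) ^ (j + 1)) ≤ 1 + Real.log (2 * x) := by
    have := Real.log_le_log (by positivity) h1
    linarith
  have hL0 : 0 ≤ 1 + Real.log (2 * (x : ℝ)) := hl0.trans hl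
  rw [Real.sqrt_mul (by positivity)]
  refine mul_le_mul_of_nonneg_left ?_ (Real.sqrt_nonneg _)
  have e : (1 + Real.log (2 * (x : ℝ))) * Real.sqrt (1 + Real.log (2 * x)) =
      Real.sqrt ((1 + Real.log (2 * x)) ^ 3) := by
    rw [pow_succ, Real.sqrt_mul (by positivity), Real.sqrt_sq hL0]
  rw [e]
  exact Real.sqrt_le_sqrt (pow_le_pow_left₀ hl0 hl 3)

/-- `log₂`: `L = ⌊log₂ x⌋ ≤ (3/2) log x ≤ (3/2)(Λ − 1)`, `Λ = 1 + log 2x`. [folklore] -/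
theorem natLog_two_le {x : ℕ} (hx : x ≠ 0) :
    (Nat.log 2 x : ℝ) ≤ 3 / 2 * Real.log x := by
  have h := Nat.pow_log_le_self 2 hx
  have hxR : (0 : ℝ) < x := by exact_mod_cast Nat.pos_of_ne_zero hx
  have h1 : ((2 : ℝ) ^ Nat.log 2 x) ≤ x := by exact_mod_cast h
  have h2 := Real.log_le_log (by positivity) h1
  rw [Real.log_pow] at h2
  have := Real.log_two_gt_d9
  nlinarith [Nat.cast_nonneg (α := ℝ) (Nat.log 2 x)]

variable (hU : ∀ z : Circle, (U z : Matrix (Fin 1) (Fin 1) ℂ) = (z : ℂ) • 1) {f : ℕ → Circle}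
  {C : ℝ} (hcarry : HasCarryProperty 2 1 C f) {γ : ℝ → ℝ} {c : ℝ} (hc : 10 ≤ c)
  (hfour : HasFourierProperty 2 γ c (umat U f)) (hmono : Monotone γ)
  (h26 : ∀ lam : ℕ, γ lam ≤ lam / 2) (ϑ : ℝ)

include hU hcarry hc hfour hmono h26 in
/-- **A type-II term of the Vaughan-type reduction** for a block `L/3 ≤ j ≤ L − L/3`
(`L = ⌊log₂ x⌋ ≥ 1024`), coefficients `|b| ≤ 1`, `λ₀ ≤ L/25`:
`√(2^{j+1}(1+log 2^{j+1})³) √(blockII) ≤ √(1944 K_II) x Λ³ 2^{−γ(λ₀)/20}`. [cite: MauduitRivat2015, §8] -/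
theorem typeII_term_le {x j : ℕ} (hx : 1024 ≤ Nat.log 2 x) (hjlo : Nat.log 2 x / 3 ≤ j)
    (hjhi : j + Nat.log 2 x / 3 ≤ Nat.log 2 x) {b : ℕ → ℝ} (hb : ∀ ℓ, |b ℓ| ≤ 1) {lam₀ : ℝ}
    (hlam₀ : lam₀ ≤ (Nat.log 2 x : ℝ) / 25) :
    Real.sqrt ((2 : ℝ) ^ (j + 1) * (1 + Real.log ((2 : ℝ) ^ (j + 1))) ^ 3) *
        Real.sqrt (blockII 2 x j b (fun n => (𝐞 (ϑ * n) : ℂ) * ((f n : Circle) : ℂ))) ≤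
      Real.sqrt (1944 * (2 + 48 * C + 4 * Real.sqrt 2 +
          32 * Real.sqrt (96 + 48 * C + 825 * 420 ^ 6 * (1 + C)))) *
        x * (1 + Real.log (2 * x)) ^ 3 * (2 : ℝ) ^ (-γ lam₀ / 20) := by
  set L := Nat.log 2 x with hL
  set KII : ℝ := 2 + 48 * C + 4 * Real.sqrt 2 + 32 * Real.sqrt (96 + 48 * C + 825 * 420 ^ 6 * (1 + C))
    with hKII
  have hL1024 : 1024 ≤ L := hx
  have hx0 : x ≠ 0 := by intro h; rw [h, Nat.log_zero_right] at hL; omega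
  have hxpos : 0 < x := Nat.pos_of_ne_zero hx0
  have hxL : 2 ^ L ≤ x := by rw [hL]; exact Nat.pow_log_le_self 2 hx0
  have hxL' : x < 2 ^ (L + 1) := by rw [hL]; exact Nat.lt_pow_succ_log_self (by norm_num) x
  have hjL : j ≤ L := by omega
  have hxR : (0 : ℝ) < x := by exact_mod_cast hxpos
  set Λx : ℝ := 1 + Real.log (2 * x) with hΛx
  have hlog2x : Real.log 2 ≤ Real.log (2 * (x : ℝ)) := Real.log_le_log (by norm_num) (by
    have : (1 : ℝ) ≤ x := by exact_mod_cast hxpos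
    linarith)
  have hlog2 := Real.log_two_gt_d9
  have hΛx1 : 1 ≤ Λx := by rw [hΛx]; linarith
  set Lr : ℝ := (L : ℝ) ^ ((3 : ℝ) / 10) with hLr
  set E : ℝ := (2 : ℝ) ^ (-γ lam₀ / 10) with hE
  have hE0 : 0 < E := Real.rpow_pos_of_pos (by norm_num) _
  -- `KII ≥ 0`, from the trivial block
  have hKII0 : 0 ≤ KII := by
    rw [hKII]
    have h1 : 0 ≤ Real.sqrt 2 := Real.sqrt_nonneg _
    have h2 : 0 ≤ Real.sqrt (96 + 48 * C + 825 * 420 ^ 6 * (1 + C)) := Real.sqrt_nonneg _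
    -- `C ≥ 0`
    have hC0 : 0 ≤ C := by
      have h := hcarry 1 0 0 (by norm_num)
      by_contra hneg
      push Not at hneg
      have hpos : (0 : ℝ) < ((2 : ℕ) : ℝ) ^ (((1 : ℕ) : ℝ) - 1 * ((0 : ℕ) : ℝ)) := by positivity
      have := mul_neg_of_neg_of_pos hneg hpos
      linarith [Nat.cast_nonneg (α := ℝ) (carryViolations 2 f 1 0 0).card]
    positivity
  -- the separation of variables
  have hUb : ∀ i ∈ sepRange 2 x j, ∀ cc : ℕ → ℂ, (∀ ℓ, ‖cc ℓ‖ ≤ 1) →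
      boxII 2 j i cc (fun n => (𝐞 (ϑ * n) : ℂ) * ((f n : Circle) : ℂ)) ≤
        KII * ((2 : ℝ) ^ (j + 1) * ((2 : ℝ) ^ (i + 1)) ^ 2) * Lr * E := by
    intro i hi cc hcc
    obtain ⟨h1, h2⟩ := mem_sepRange_bounds hx0 hi hjL
    rw [boxII_eq_typeIISq hU f ϑ 2 j i cc]
    have hB : ∀ n, ‖cc n • (1 : Matrix (Fin 1) (Fin 1) ℂ)‖ ≤ 1 := fun n => by
      rw [norm_smul_one_fin_one]; exact hcc n
    have h := typeIISq_base2_block U hcarry hc hfour hmono h26 ϑ hB hL1024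
      (show L / 3 + 1 ≤ j + 1 by omega) (show j + 1 + L / 3 ≤ L + 1 by omega)
      (show L ≤ j + 1 + (i + 1) by omega) (show j + 1 + (i + 1) ≤ L + 2 by omega) hlam₀
    simpa using h
  have hsep := blockII_le_of_boxII (le_refl 2) hb (fun n => (𝐞 (ϑ * n) : ℂ) * ((f n : Circle) : ℂ)) hUb
  -- the sum over the separated blocks
  have hsum : ∑ i ∈ sepRange 2 x j, KII * ((2 : ℝ) ^ (j + 1) * ((2 : ℝ) ^ (i + 1)) ^ 2) * Lr * E ≤
      3 * (KII * ((2 : ℝ) ^ (j + 1) * ((2 : ℝ) ^ (L - j + 1)) ^ 2) * Lr * E) := by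
    have hterm : ∀ i ∈ sepRange 2 x j, KII * ((2 : ℝ) ^ (j + 1) * ((2 : ℝ) ^ (i + 1)) ^ 2) * Lr * E ≤
        KII * ((2 : ℝ) ^ (j + 1) * ((2 : ℝ) ^ (L - j + 1)) ^ 2) * Lr * E := by
      intro i hi
      have h1 := (mem_sepRange_bounds hx0 hi hjL).1
      have : (2 : ℝ) ^ (i + 1) ≤ (2 : ℝ) ^ (L - j + 1) := pow_le_pow_right₀ (by norm_num) (by omega)
      gcongr
    calc ∑ i ∈ sepRange 2 x j, KII * ((2 : ℝ) ^ (j + 1) * ((2 : ℝ) ^ (i + 1)) ^ 2) * Lr * E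
        ≤ ∑ _i ∈ sepRange 2 x j, KII * ((2 : ℝ) ^ (j + 1) * ((2 : ℝ) ^ (L - j + 1)) ^ 2) * Lr * E :=
          sum_le_sum hterm
      _ = (sepRange 2 x j).card * (KII * ((2 : ℝ) ^ (j + 1) * ((2 : ℝ) ^ (L - j + 1)) ^ 2) * Lr * E) := by
          rw [sum_const, nsmul_eq_mul]
      _ ≤ _ := by
          have : ((sepRange 2 x j).card : ℝ) ≤ 3 := by exact_mod_cast card_sepRange_le (le_refl 2) x j
          exact mul_le_mul_of_nonneg_right this (by positivity)
  -- `(3 + log(x/2^j + 1))² ≤ (3Λ)²`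
  have hlogsep : 3 + Real.log (((x / 2 ^ j : ℕ) : ℝ) + 1) ≤ 3 * Λx := by
    have h1 : (((x / 2 ^ j : ℕ) : ℝ) + 1) ≤ 2 * x := by
      have : ((x / 2 ^ j : ℕ) : ℝ) ≤ x := by exact_mod_cast Nat.div_le_self _ _
      have : (1 : ℝ) ≤ x := by exact_mod_cast hxpos
      linarith
    have h2 := Real.log_le_log (by positivity) h1
    rw [hΛx]; linarith
  have hlogsep0 : 0 ≤ 3 + Real.log (((x / 2 ^ j : ℕ) : ℝ) + 1) := by
    have : 0 ≤ Real.log (((x / 2 ^ j : ℕ) : ℝ) + 1) := Real.log_nonneg (by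
      have : (0 : ℝ) ≤ ((x / 2 ^ j : ℕ) : ℝ) := Nat.cast_nonneg _
      linarith)
    linarith
  -- `2^{j+1} 4^{L-j+1} ≤ 8 x² / 2^j`, i.e. `2^j · 2^{j+1} · 4^{L-j+1} ≤ 8 x²`
  have hgeo : (2 : ℝ) ^ j * ((2 : ℝ) ^ (j + 1) * ((2 : ℝ) ^ (L - j + 1)) ^ 2) ≤ 8 * (x : ℝ) ^ 2 := by
    have e : (2 : ℝ) ^ j * ((2 : ℝ) ^ (j + 1) * ((2 : ℝ) ^ (L - j + 1)) ^ 2) = 8 * ((2 : ℝ) ^ L) ^ 2 := by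
      have : (2 : ℝ) ^ j * (2 : ℝ) ^ (L - j) = (2 : ℝ) ^ L := by rw [← pow_add]; congr 1; omega
      calc (2 : ℝ) ^ j * ((2 : ℝ) ^ (j + 1) * ((2 : ℝ) ^ (L - j + 1)) ^ 2)
          = 8 * ((2 : ℝ) ^ j * (2 : ℝ) ^ (L - j)) ^ 2 := by ring
        _ = _ := by rw [this]
    rw [e]
    have : ((2 : ℝ) ^ L) ≤ x := by exact_mod_cast hxL
    gcongr
  -- `Lr ≤ (3/2) Λ`
  have hLr : Lr ≤ 3 / 2 * Λx := by
    have hL1 : (1 : ℝ) ≤ L := by exact_mod_cast (show 1 ≤ L by omega)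
    calc Lr ≤ (L : ℝ) ^ (1 : ℝ) := Real.rpow_le_rpow_of_exponent_le hL1 (by norm_num)
      _ = L := Real.rpow_one _
      _ ≤ 3 / 2 * Real.log x := natLog_two_le hx0
      _ ≤ 3 / 2 * Λx := by
          rw [hΛx]
          have : Real.log (x : ℝ) ≤ Real.log (2 * x) := Real.log_le_log hxR (by linarith)
          linarith
  -- assemble the bound for `blockII`
  have hcard : ((sepRange 2 x j).card : ℝ) ≤ 3 := by exact_mod_cast card_sepRange_le (le_refl 2) x j
  have hblock : blockII 2 x j b (fun n => (𝐞 (ϑ * n) : ℂ) * ((f n : Circle) : ℂ)) ≤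
      (3 * Λx) ^ 2 * 3 * (3 * (KII * ((2 : ℝ) ^ (j + 1) * ((2 : ℝ) ^ (L - j + 1)) ^ 2) * Lr * E)) := by
    refine hsep.trans ?_
    have h0 : 0 ≤ ∑ i ∈ sepRange 2 x j, KII * ((2 : ℝ) ^ (j + 1) * ((2 : ℝ) ^ (i + 1)) ^ 2) * Lr * E :=
      sum_nonneg fun i _ => by positivity
    exact mul_le_mul (mul_le_mul (pow_le_pow_left₀ hlogsep0 hlogsep 2) hcard (Nat.cast_nonneg _)
      (by positivity)) hsum h0 (by positivity)
  -- the product with the weight, squared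
  have hW := vaughanWeight_le hxpos (by
    calc 2 ^ (j + 1) ≤ 2 ^ (L + 1) := Nat.pow_le_pow_right (by norm_num) (by omega)
      _ = 2 * 2 ^ L := by rw [pow_succ']
      _ ≤ 2 * x := by omega)
  have hbnn : 0 ≤ blockII 2 x j b (fun n => (𝐞 (ϑ * n) : ℂ) * ((f n : Circle) : ℂ)) :=
    MRVaughan.blockII_nonneg _ _ _ _ _
  have hprod : (2 : ℝ) ^ (j + 1) * (Λx * Real.sqrt Λx) ^ 2 *
      ((3 * Λx) ^ 2 * 3 * (3 * (KII * ((2 : ℝ) ^ (j + 1) * ((2 : ℝ) ^ (L - j + 1)) ^ 2) * Lr * E))) ≤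
      (Real.sqrt (1944 * KII) * x * Λx ^ 3 * (2 : ℝ) ^ (-γ lam₀ / 20)) ^ 2 := by
    have e1 : (Λx * Real.sqrt Λx) ^ 2 = Λx ^ 3 := by
      rw [mul_pow, Real.sq_sqrt (by linarith)]; ring
    have hE2 : ((2 : ℝ) ^ (-γ lam₀ / 20)) ^ 2 = E := by
      rw [hE, ← Real.rpow_natCast ((2 : ℝ) ^ (-γ lam₀ / 20)) 2, ← Real.rpow_mul (by norm_num)]
      congr 1
      push_cast
      ring
    have e2 : (Real.sqrt (1944 * KII) * x * Λx ^ 3 * (2 : ℝ) ^ (-γ lam₀ / 20)) ^ 2 =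
        1944 * KII * x ^ 2 * Λx ^ 6 * E := by
      rw [mul_pow, mul_pow, mul_pow, Real.sq_sqrt (by positivity), hE2]
      ring
    rw [e1, e2]
    -- LHS = 81 KII Λx^5 Lr E · (2^j 2^{j+1} 4^{L-j+1}) / ... rewrite with hgeo
    have h1 : (2 : ℝ) ^ (j + 1) * Λx ^ 3 *
        ((3 * Λx) ^ 2 * 3 * (3 * (KII * ((2 : ℝ) ^ (j + 1) * ((2 : ℝ) ^ (L - j + 1)) ^ 2) * Lr * E))) =
        162 * KII * Λx ^ 5 * Lr * E * ((2 : ℝ) ^ j * ((2 : ℝ) ^ (j + 1) * ((2 : ℝ) ^ (L - j + 1)) ^ 2)) := by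
      ring
    rw [h1]
    have h2 : 162 * KII * Λx ^ 5 * Lr * E * ((2 : ℝ) ^ j * ((2 : ℝ) ^ (j + 1) * ((2 : ℝ) ^ (L - j + 1)) ^ 2)) ≤
        162 * KII * Λx ^ 5 * (3 / 2 * Λx) * E * (8 * (x : ℝ) ^ 2) := by
      have hΛ0 : 0 ≤ Λx := by linarith
      gcongr
    refine h2.trans (le_of_eq ?_)
    ring
  -- conclude by taking square roots
  have hlhs0 : 0 ≤ Real.sqrt ((2 : ℝ) ^ (j + 1) * (1 + Real.log ((2 : ℝ) ^ (j + 1))) ^ 3) *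
      Real.sqrt (blockII 2 x j b (fun n => (𝐞 (ϑ * n) : ℂ) * ((f n : Circle) : ℂ))) := by positivity
  have hrhs0 : 0 ≤ Real.sqrt (1944 * KII) * x * Λx ^ 3 * (2 : ℝ) ^ (-γ lam₀ / 20) := by positivity
  have hsq : (Real.sqrt ((2 : ℝ) ^ (j + 1) * (1 + Real.log ((2 : ℝ) ^ (j + 1))) ^ 3) *
      Real.sqrt (blockII 2 x j b (fun n => (𝐞 (ϑ * n) : ℂ) * ((f n : Circle) : ℂ)))) ^ 2 ≤
      (Real.sqrt (1944 * KII) * x * Λx ^ 3 * (2 : ℝ) ^ (-γ lam₀ / 20)) ^ 2 := by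
    calc (Real.sqrt ((2 : ℝ) ^ (j + 1) * (1 + Real.log ((2 : ℝ) ^ (j + 1))) ^ 3) *
          Real.sqrt (blockII 2 x j b (fun n => (𝐞 (ϑ * n) : ℂ) * ((f n : Circle) : ℂ)))) ^ 2
        ≤ (Real.sqrt ((2 : ℝ) ^ (j + 1)) * (Λx * Real.sqrt Λx) *
            Real.sqrt (blockII 2 x j b (fun n => (𝐞 (ϑ * n) : ℂ) * ((f n : Circle) : ℂ)))) ^ 2 := by
          refine pow_le_pow_left₀ hlhs0 (mul_le_mul_of_nonneg_right hW (Real.sqrt_nonneg _)) 2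
      _ = (2 : ℝ) ^ (j + 1) * (Λx * Real.sqrt Λx) ^ 2 *
            blockII 2 x j b (fun n => (𝐞 (ϑ * n) : ℂ) * ((f n : Circle) : ℂ)) := by
          rw [mul_pow, mul_pow, Real.sq_sqrt (by positivity), Real.sq_sqrt hbnn]
      _ ≤ (2 : ℝ) ^ (j + 1) * (Λx * Real.sqrt Λx) ^ 2 *
            ((3 * Λx) ^ 2 * 3 * (3 * (KII * ((2 : ℝ) ^ (j + 1) * ((2 : ℝ) ^ (L - j + 1)) ^ 2) * Lr * E))) :=
          mul_le_mul_of_nonneg_left hblock (by positivity)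
      _ ≤ _ := hprod
  exact (pow_le_pow_iff_left₀ hlhs0 hrhs0 two_ne_zero).1 hsq

include hU hcarry hc hfour hmono h26 in
/-- **A type-I term of the Vaughan-type reduction** for a block `j ≤ L/3`:
`√(2^{j+1}(1+log 2^{j+1})³) √(min(x/2^j · blockI, ·)) ≤ √(16(1 + 2√2√C)) x Λ³ 2^{−γ(λ₀)/20}`.
[cite: MauduitRivat2015, §8] -/
theorem typeI_term_le {x j : ℕ} (hx : 1024 ≤ Nat.log 2 x) (hj : j ≤ Nat.log 2 x / 3) {lam₀ : ℝ}
    (hlam₀ : lam₀ ≤ (Nat.log 2 x : ℝ) / 25) (hγ₀ : 0 ≤ γ lam₀) (Y : ℝ) :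
    Real.sqrt ((2 : ℝ) ^ (j + 1) * (1 + Real.log ((2 : ℝ) ^ (j + 1))) ^ 3) *
        Real.sqrt (min ((x : ℝ) / (2 : ℝ) ^ j * blockI 2 x j (fun n => (𝐞 (ϑ * n) : ℂ) * ((f n : Circle) : ℂ))) Y) ≤
      Real.sqrt (16 * (1 + 2 * Real.sqrt 2 * Real.sqrt C)) * x * (1 + Real.log (2 * x)) ^ 3 *
        (2 : ℝ) ^ (-γ lam₀ / 20) := by
  set L := Nat.log 2 x with hL
  have hL1024 : 1024 ≤ L := hx
  have hx0 : x ≠ 0 := by intro h; rw [h, Nat.log_zero_right] at hL; omega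
  have hxpos : 0 < x := Nat.pos_of_ne_zero hx0
  have hxL : 2 ^ L ≤ x := by rw [hL]; exact Nat.pow_log_le_self 2 hx0
  have hjL : j ≤ L := le_trans hj (Nat.div_le_self _ _)
  have hxR : (0 : ℝ) < x := by exact_mod_cast hxpos
  set Λx : ℝ := 1 + Real.log (2 * x) with hΛx
  have hlog2x : Real.log 2 ≤ Real.log (2 * (x : ℝ)) := Real.log_le_log (by norm_num) (by
    have : (1 : ℝ) ≤ x := by exact_mod_cast hxpos
    linarith)
  have hlog2 := Real.log_two_gt_d9
  have hΛx1 : 1 ≤ Λx := by rw [hΛx]; linarith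
  have hC0 : 0 ≤ C := by
    have h := hcarry 1 0 0 (by norm_num)
    by_contra hneg
    push Not at hneg
    have hpos : (0 : ℝ) < ((2 : ℕ) : ℝ) ^ (((1 : ℕ) : ℝ) - 1 * ((0 : ℕ) : ℝ)) := by positivity
    have := mul_neg_of_neg_of_pos hneg hpos
    linarith [Nat.cast_nonneg (α := ℝ) (carryViolations 2 f 1 0 0).card]
  set KI : ℝ := 8 * (1 + 2 * Real.sqrt 2 * Real.sqrt C) with hKI
  have hKI0 : 0 ≤ KI := by positivity
  have hI := blockI_base2_le U hU hcarry hc hfour hmono h26 ϑ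
    (le_trans (Nat.pow_le_pow_right (by norm_num) (by omega : 6 ≤ L)) hxL) hj hlam₀ hγ₀
  have hbI0 : 0 ≤ blockI 2 x j (fun n => (𝐞 (ϑ * n) : ℂ) * ((f n : Circle) : ℂ)) :=
    MRVaughan.blockI_nonneg _ _ _ _
  set a : ℝ := (x : ℝ) / (2 : ℝ) ^ j * blockI 2 x j (fun n => (𝐞 (ϑ * n) : ℂ) * ((f n : Circle) : ℂ)) with ha
  have ha0 : 0 ≤ a := by positivity
  have hmin : Real.sqrt (min a Y) ≤ Real.sqrt a := Real.sqrt_le_sqrt (min_le_left _ _)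
  have hW := vaughanWeight_le hxpos (by
    calc 2 ^ (j + 1) ≤ 2 ^ (L + 1) := Nat.pow_le_pow_right (by norm_num) (by omega)
      _ = 2 * 2 ^ L := by rw [pow_succ']
      _ ≤ 2 * x := by omega)
  have hE : (2 : ℝ) ^ (-γ lam₀ / 2) ≤ ((2 : ℝ) ^ (-γ lam₀ / 20)) ^ 2 := by
    rw [← Real.rpow_natCast ((2 : ℝ) ^ (-γ lam₀ / 20)) 2, ← Real.rpow_mul (by norm_num)]
    exact Real.rpow_le_rpow_of_exponent_le (by norm_num) (by push_cast; linarith)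
  have hlhs0 : 0 ≤ Real.sqrt ((2 : ℝ) ^ (j + 1) * (1 + Real.log ((2 : ℝ) ^ (j + 1))) ^ 3) *
      Real.sqrt (min a Y) := by positivity
  have hrhs0 : 0 ≤ Real.sqrt (16 * (1 + 2 * Real.sqrt 2 * Real.sqrt C)) * x * Λx ^ 3 *
      (2 : ℝ) ^ (-γ lam₀ / 20) := by positivity
  have hsq : (Real.sqrt ((2 : ℝ) ^ (j + 1) * (1 + Real.log ((2 : ℝ) ^ (j + 1))) ^ 3) *
      Real.sqrt (min a Y)) ^ 2 ≤
      (Real.sqrt (16 * (1 + 2 * Real.sqrt 2 * Real.sqrt C)) * x * Λx ^ 3 * (2 : ℝ) ^ (-γ lam₀ / 20)) ^ 2 := by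
    calc (Real.sqrt ((2 : ℝ) ^ (j + 1) * (1 + Real.log ((2 : ℝ) ^ (j + 1))) ^ 3) * Real.sqrt (min a Y)) ^ 2
        ≤ (Real.sqrt ((2 : ℝ) ^ (j + 1)) * (Λx * Real.sqrt Λx) * Real.sqrt a) ^ 2 :=
          pow_le_pow_left₀ hlhs0 (mul_le_mul hW hmin (Real.sqrt_nonneg _) (by positivity)) 2
      _ = (2 : ℝ) ^ (j + 1) * Λx ^ 3 * a := by
          rw [mul_pow, mul_pow, Real.sq_sqrt (by positivity), Real.sq_sqrt ha0, mul_pow,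
            Real.sq_sqrt (by linarith)]
          ring
      _ ≤ (2 : ℝ) ^ (j + 1) * Λx ^ 3 * ((x : ℝ) / (2 : ℝ) ^ j *
            (KI * x * (Λx ^ 2 * Real.sqrt Λx) * (2 : ℝ) ^ (-γ lam₀ / 2))) := by
          rw [ha]
          refine mul_le_mul_of_nonneg_left (mul_le_mul_of_nonneg_left hI (by positivity)) (by positivity)
      _ = 2 * KI * x ^ 2 * (Λx ^ 5 * Real.sqrt Λx) * (2 : ℝ) ^ (-γ lam₀ / 2) := by
          field_simp
          ring
      _ ≤ 2 * KI * x ^ 2 * (Λx ^ 5 * Λx) * ((2 : ℝ) ^ (-γ lam₀ / 20)) ^ 2 := by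
          have hsΛ : Real.sqrt Λx ≤ Λx := by
            calc Real.sqrt Λx ≤ Real.sqrt (Λx ^ 2) := Real.sqrt_le_sqrt (by nlinarith)
              _ = Λx := Real.sqrt_sq (by linarith)
          gcongr
      _ = _ := by
          rw [mul_pow, mul_pow, mul_pow, Real.sq_sqrt (by positivity), hKI]
          ring
  exact (pow_le_pow_iff_left₀ hlhs0 hrhs0 two_ne_zero).1 hsq

/-- `‖∑_{n ∈ s} μ(n) g(n)‖ ≤ #s` for `‖g‖ ≤ 1`. [folklore] -/
theorem norm_sum_moebius_smul_le_card {E : Type*} [NormedAddCommGroup E] [NormedSpace ℝ E]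
    (s : Finset ℕ) {g : ℕ → E} (hg : ∀ n, ‖g n‖ ≤ 1) :
    ‖∑ n ∈ s, (μ n : ℝ) • g n‖ ≤ s.card := by
  calc ‖∑ n ∈ s, (μ n : ℝ) • g n‖ ≤ ∑ n ∈ s, ‖(μ n : ℝ) • g n‖ := norm_sum_le _ _
    _ ≤ ∑ _n ∈ s, (1 : ℝ) := by
        refine sum_le_sum fun n _ => ?_
        rw [norm_smul]
        have h1 : ‖(μ n : ℝ)‖ ≤ 1 := by
          rw [Real.norm_eq_abs]
          exact_mod_cast ArithmeticFunction.abs_moebius_le_one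
        calc ‖(μ n : ℝ)‖ * ‖g n‖ ≤ 1 * 1 := mul_le_mul h1 (hg n) (norm_nonneg _) zero_le_one
          _ = 1 := one_mul _
    _ = s.card := by rw [sum_const, nsmul_eq_mul, mul_one]

/-- The phase-twisted sequence `g(n) = e(ϑn) f(n)` is bounded by `1`. [folklore] -/
theorem norm_twist_circle_le (f : ℕ → Circle) (ϑ : ℝ) (n : ℕ) :
    ‖(𝐞 (ϑ * n) : ℂ) * ((f n : Circle) : ℂ)‖ ≤ 1 := by
  rw [norm_mul, norm_fourierChar, Circle.norm_coe, one_mul]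

include hU hcarry hc hfour hmono h26 in
/-- **A hyperbolic piece**: for `⌊log₂ x⌋ ≥ 1024`, `λ₀ ≤ ⌊log₂ x⌋/25`, `γ(λ₀) ≥ 0`,
`‖∑_{x/2 < n ≤ x} μ(n) e(ϑn) f(n)‖ ≤ K_p(C) x (1 + log 2x)⁴ 2^{−γ(λ₀)/20}` (Vaughan-type
identity with `u = 2^{⌊L/3⌋}`, type-I blocks `j ≤ L/3`, type-II blocks otherwise).
[cite: MauduitRivat2015, §8, (13.x)–Prop. 1–2] -/
theorem piece_le {x : ℕ} (hx : 1024 ≤ Nat.log 2 x) {lam₀ : ℝ} (hlam₀ : lam₀ ≤ (Nat.log 2 x : ℝ) / 25)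
    (hγ₀ : 0 ≤ γ lam₀) :
    ‖∑ n ∈ (Ioc 0 x).filter (fun n => x < 2 * n),
        (μ n : ℝ) • ((𝐞 (ϑ * n) : ℂ) * ((f n : Circle) : ℂ))‖ ≤
      3 * (Real.sqrt (16 * (1 + 2 * Real.sqrt 2 * Real.sqrt C)) +
          2 * Real.sqrt (1944 * (2 + 48 * C + 4 * Real.sqrt 2 +
            32 * Real.sqrt (96 + 48 * C + 825 * 420 ^ 6 * (1 + C))))) *
        x * (1 + Real.log (2 * x)) ^ 4 * (2 : ℝ) ^ (-γ lam₀ / 20) := by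
  set L := Nat.log 2 x with hL
  set U₀ := L / 3 with hU₀
  have hL1024 : 1024 ≤ L := hx
  have hx0 : x ≠ 0 := by intro h; rw [h, Nat.log_zero_right] at hL; omega
  have hxpos : 0 < x := Nat.pos_of_ne_zero hx0
  have hxL : 2 ^ L ≤ x := by rw [hL]; exact Nat.pow_log_le_self 2 hx0
  have hxR : (0 : ℝ) < x := by exact_mod_cast hxpos
  set g : ℕ → ℂ := fun n => (𝐞 (ϑ * n) : ℂ) * ((f n : Circle) : ℂ) with hg
  have hg1 : ∀ n, ‖g n‖ ≤ 1 := norm_twist_circle_le f ϑ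
  -- Vaughan's identity with `u = 2^{U₀}`
  have hu : 2 * 2 ^ U₀ ≤ x := by
    calc 2 * 2 ^ U₀ = 2 ^ (U₀ + 1) := by rw [pow_succ']
      _ ≤ 2 ^ L := Nat.pow_le_pow_right (by norm_num) (by omega)
      _ ≤ x := hxL
  have hV := norm_sum_moebius_smul_le_blocks (q := 2) (le_refl 2) hu hg1
  have hlog1 : Nat.log 2 (2 ^ U₀ * 2 ^ U₀) = 2 * U₀ := by
    rw [← pow_add, Nat.log_pow (by norm_num)]; ring
  have hlog2 : Nat.log 2 (2 ^ U₀) = U₀ := Nat.log_pow (by norm_num) _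
  rw [hlog1, hlog2] at hV
  simp only [Nat.cast_ofNat] at hV
  -- the constants
  set Λx : ℝ := 1 + Real.log (2 * x) with hΛx
  have hlog2x : Real.log 2 ≤ Real.log (2 * (x : ℝ)) := Real.log_le_log (by norm_num) (by
    have : (1 : ℝ) ≤ x := by exact_mod_cast hxpos
    linarith)
  have hlog2 := Real.log_two_gt_d9
  have hΛx1 : 1 ≤ Λx := by rw [hΛx]; linarith
  set E : ℝ := (2 : ℝ) ^ (-γ lam₀ / 20) with hE
  have hE0 : 0 < E := Real.rpow_pos_of_pos (by norm_num) _
  set E1 : ℝ := Real.sqrt (16 * (1 + 2 * Real.sqrt 2 * Real.sqrt C)) * x * Λx ^ 3 * E with hE1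
  set E2 : ℝ := Real.sqrt (1944 * (2 + 48 * C + 4 * Real.sqrt 2 +
      32 * Real.sqrt (96 + 48 * C + 825 * 420 ^ 6 * (1 + C)))) * x * Λx ^ 3 * E with hE2
  have hE10 : 0 ≤ E1 := by positivity
  have hE20 : 0 ≤ E2 := by positivity
  -- the terms of the first sum
  have hfirst : ∀ j ∈ range (2 * U₀ + 1),
      Real.sqrt ((2 : ℝ) ^ (j + 1) * (1 + Real.log ((2 : ℝ) ^ (j + 1))) ^ 3) *
        Real.sqrt (min ((x : ℝ) / (2 : ℝ) ^ j * blockI 2 x j g) (blockII 2 x j (fun _ => 1) g)) ≤ E1 + E2 := by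
    intro j hj
    rw [mem_range] at hj
    by_cases hjU : j ≤ U₀
    · calc _ ≤ E1 := typeI_term_le hU hcarry hc hfour hmono h26 ϑ hx hjU hlam₀ hγ₀
            (blockII 2 x j (fun _ => 1) g)
        _ ≤ E1 + E2 := le_add_of_nonneg_right hE20
    · have hmin : Real.sqrt (min ((x : ℝ) / (2 : ℝ) ^ j * blockI 2 x j g) (blockII 2 x j (fun _ => 1) g)) ≤
          Real.sqrt (blockII 2 x j (fun _ => 1) g) := Real.sqrt_le_sqrt (min_le_right _ _)
      have h0 : 0 ≤ Real.sqrt ((2 : ℝ) ^ (j + 1) * (1 + Real.log ((2 : ℝ) ^ (j + 1))) ^ 3) :=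
        Real.sqrt_nonneg _
      calc _ ≤ Real.sqrt ((2 : ℝ) ^ (j + 1) * (1 + Real.log ((2 : ℝ) ^ (j + 1))) ^ 3) *
            Real.sqrt (blockII 2 x j (fun _ => 1) g) := mul_le_mul_of_nonneg_left hmin h0
        _ ≤ E2 := typeII_term_le hU hcarry hc hfour hmono h26 ϑ hx (by omega) (by omega)
            (b := fun _ => (1 : ℝ)) (fun _ => by simp) hlam₀
        _ ≤ E1 + E2 := le_add_of_nonneg_left hE10
  -- the terms of the second sum
  have hsecond : ∀ j ∈ Ico U₀ (L + 1),
      Real.sqrt ((2 : ℝ) ^ (j + 1) * (1 + Real.log ((2 : ℝ) ^ (j + 1))) ^ 3) *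
        Real.sqrt (blockII 2 x j (typeIICoeffB (2 ^ U₀)) g) ≤ E2 := by
    intro j hj
    rw [mem_Ico] at hj
    by_cases hjhi : j + U₀ ≤ L
    · exact typeII_term_le hU hcarry hc hfour hmono h26 ϑ hx hj.1 hjhi (abs_typeIICoeffB_le _) hlam₀
    · have hzero : blockII 2 x j (typeIICoeffB (2 ^ U₀)) g = 0 := by
        refine blockII_typeIICoeffB_eq_zero ?_ g
        have hxL' : x < 2 ^ (L + 1) := by rw [hL]; exact Nat.lt_pow_succ_log_self (by norm_num) x
        calc x < 2 ^ (L + 1) := hxL'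
          _ ≤ 2 ^ (j + U₀) := Nat.pow_le_pow_right (by norm_num) (by omega)
          _ = 2 ^ j * 2 ^ U₀ := pow_add _ _ _
          _ ≤ 2 ^ j * (2 ^ U₀ + 1) := Nat.mul_le_mul_left _ (by omega)
      rw [hzero, Real.sqrt_zero, mul_zero]
      exact hE20
  -- the number of terms
  have hcount : ((L + 1 : ℕ) : ℝ) ≤ 3 * Λx := by
    have h1 := natLog_two_le hx0
    have h2 : Real.log (x : ℝ) ≤ Real.log (2 * x) := Real.log_le_log hxR (by linarith)
    rw [← hL] at h1
    push_cast
    rw [hΛx]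
    linarith
  calc ‖∑ n ∈ (Ioc 0 x).filter (fun n => x < 2 * n), (μ n : ℝ) • g n‖
      ≤ _ := hV
    _ ≤ ∑ _j ∈ range (2 * U₀ + 1), (E1 + E2) + ∑ _j ∈ Ico U₀ (L + 1), E2 :=
        add_le_add (sum_le_sum hfirst) (sum_le_sum hsecond)
    _ = ((2 * U₀ + 1 : ℕ) : ℝ) * (E1 + E2) + ((L + 1 - U₀ : ℕ) : ℝ) * E2 := by
        rw [sum_const, card_range, nsmul_eq_mul, sum_const, Nat.card_Ico, nsmul_eq_mul]
    _ ≤ ((L + 1 : ℕ) : ℝ) * (E1 + E2) + ((L + 1 : ℕ) : ℝ) * E2 := by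
        have h1 : ((2 * U₀ + 1 : ℕ) : ℝ) ≤ ((L + 1 : ℕ) : ℝ) := by exact_mod_cast (by omega : 2 * U₀ + 1 ≤ L + 1)
        have h2 : ((L + 1 - U₀ : ℕ) : ℝ) ≤ ((L + 1 : ℕ) : ℝ) := by exact_mod_cast Nat.sub_le _ _
        gcongr
    _ ≤ (3 * Λx) * (E1 + E2) + (3 * Λx) * E2 := by gcongr
    _ = _ := by rw [hE1, hE2]; ring

/-- **Dyadic decomposition**: `(0, x] = ⋃_{i<I} (x/2^{i+1}, x/2^i] ∪ (0, x/2^I]`. [folklore] -/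
theorem sum_Ioc_eq_sum_pieces {M : Type*} [AddCommMonoid M] (F : ℕ → M) (x I : ℕ) :
    ∑ n ∈ Ioc 0 x, F n =
      ∑ i ∈ range I, ∑ n ∈ (Ioc 0 (x / 2 ^ i)).filter (fun n => x / 2 ^ i < 2 * n), F n +
        ∑ n ∈ Ioc 0 (x / 2 ^ I), F n := by
  induction I with
  | zero => simp
  | succ I ih =>
    rw [ih, sum_range_succ, add_assoc]
    congr 1
    have hy : x / 2 ^ (I + 1) = x / 2 ^ I / 2 := by rw [pow_succ, Nat.div_div_eq_div_mul]
    rw [hy, ← sum_filter_add_sum_filter_not (Ioc 0 (x / 2 ^ I)) (fun n => x / 2 ^ I < 2 * n) F]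
    congr 2
    ext n
    simp only [mem_filter, mem_Ioc, not_lt]
    constructor
    · rintro ⟨⟨h1, _⟩, h3⟩
      exact ⟨h1, (Nat.le_div_iff_mul_le (by norm_num)).2 (by linarith)⟩
    · rintro ⟨h1, h2⟩
      have := (Nat.le_div_iff_mul_le (by norm_num)).1 h2
      exact ⟨⟨h1, by omega⟩, by linarith⟩

/-- `⌊log₂ (x / 2^i)⌋ = ⌊log₂ x⌋ − i` for `i ≤ ⌊log₂ x⌋`. [folklore] -/
theorem natLog_two_div_pow {x i : ℕ} (hx : x ≠ 0) (hi : i ≤ Nat.log 2 x) :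
    Nat.log 2 (x / 2 ^ i) = Nat.log 2 x - i := by
  have hxL : 2 ^ Nat.log 2 x ≤ x := Nat.pow_log_le_self 2 hx
  have hxL' : x < 2 ^ (Nat.log 2 x + 1) := Nat.lt_pow_succ_log_self (by norm_num) x
  refine Nat.log_eq_of_pow_le_of_lt_pow ?_ ?_
  · rw [Nat.le_div_iff_mul_le (by positivity), ← pow_add]
    calc 2 ^ (Nat.log 2 x - i + i) = 2 ^ Nat.log 2 x := by congr 1; omega
      _ ≤ x := hxL
  · rw [Nat.div_lt_iff_lt_mul (by positivity), ← pow_add]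
    calc x < 2 ^ (Nat.log 2 x + 1) := hxL'
      _ = 2 ^ (Nat.log 2 x - i + 1 + i) := by congr 1; omega

end Pieces

end Literature.NumberTheory.LFunctions.MauduitRivat

/-! ## Proof of the named fact -/

namespace Literature.NumberTheory.LFunctions

open MauduitRivat
open scoped ArithmeticFunction.Moebius

set_option maxHeartbeats 1600000 in
/-- **Mauduit–Rivat 2015, Theorem 2 in base 2** (the named fact `mauduitRivat2015_thm2_base2`),
proved: pieces `x/2^{i+1} < n ≤ x/2^i` for `i ≤ L/4` by `piece_le` (`L = ⌊log₂ x⌋ ≥ 1400`), the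
deeper pieces and small `x` trivially, using `γ(λ) ≤ λ/2` (26).
[cite: MauduitRivat2015, Theorem 2, (10), §8] -/
theorem mauduitRivat2015_thm2_base2_holds : mauduitRivat2015_thm2_base2 := by
  intro C c hc
  set Kp : ℝ := 3 * (Real.sqrt (16 * (1 + 2 * Real.sqrt 2 * Real.sqrt C)) +
    2 * Real.sqrt (1944 * (2 + 48 * C + 4 * Real.sqrt 2 +
      32 * Real.sqrt (96 + 48 * C + 825 * 420 ^ 6 * (1 + C))))) with hKp
  have hKp0 : 0 ≤ Kp := by positivity
  refine ⟨32 * Kp + 10, ?_⟩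
  intro γ hmono _ f hcarry hfour x hx2 ϑ
  obtain ⟨U, hU⟩ := exists_circle_unitaryHom
  have hfourU := hasFourierProperty_umat_circle hU hfour
  have hc0 : (0 : ℝ) ≤ c := by linarith
  have h26 : ∀ lam : ℕ, γ lam ≤ lam / 2 :=
    gamma_le_half (le_refl 2) hc0 (fun n => Circle.norm_coe (f n)) hfour
  -- the sum as `∑ μ(n) • g(n)` over `(0, x]`
  set g : ℕ → ℂ := fun n => (𝐞 (ϑ * n) : ℂ) * ((f n : Circle) : ℂ) with hg
  have hg1 : ∀ n, ‖g n‖ ≤ 1 := norm_twist_circle_le f ϑ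
  have hsum : ∑ n ∈ Finset.Icc 1 x, (ArithmeticFunction.moebius n : ℂ) * (f n : ℂ) *
      Complex.exp (2 * Real.pi * Complex.I * (ϑ * n)) = ∑ n ∈ Ioc 0 x, (μ n : ℝ) • g n := by
    rw [show Finset.Icc 1 x = Ioc 0 x from Finset.Icc_add_one_left_eq_Ioc 0 x]
    refine sum_congr rfl fun n _ => ?_
    have hexp : Complex.exp (2 * Real.pi * Complex.I * (ϑ * n)) = (𝐞 (ϑ * n) : ℂ) := by
      rw [Real.fourierChar_apply]
      congr 1
      push_cast
      ring
    rw [hexp, hg, Complex.real_smul]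
    push_cast
    ring
  rw [hsum]
  -- the exponent
  set ρt : ℕ := ⌊Real.log x / (80 * Real.log 2)⌋₊ with hρt
  have hxR : (2 : ℝ) ≤ x := by exact_mod_cast hx2
  have hxpos : (0 : ℝ) < x := by linarith
  have hlog2 := Real.log_two_gt_d9
  have hlog2' := Real.log_two_lt_d9
  have hlogx : Real.log 2 ≤ Real.log x := Real.log_le_log (by norm_num) hxR
  have hlogx0 : 0 < Real.log (x : ℝ) := by linarith
  have hρtle : (ρt : ℝ) ≤ Real.log x / (80 * Real.log 2) := Nat.floor_le (by positivity)
  have hγ₀le : γ (2 * (ρt : ℝ)) ≤ ρt := by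
    have := h26 (2 * ρt); push_cast at this; linarith
  set E : ℝ := (2 : ℝ) ^ (-(γ (2 * (ρt : ℝ))) / 20) with hE
  have hE0 : 0 < E := Real.rpow_pos_of_pos (by norm_num) _
  have hlog4 : (1 : ℝ) / 5 ≤ Real.log x ^ 4 := by
    have : (0.69 : ℝ) ≤ Real.log x := by linarith
    calc (1 : ℝ) / 5 ≤ (0.69 : ℝ) ^ 4 := by norm_num
      _ ≤ Real.log x ^ 4 := pow_le_pow_left₀ (by norm_num) this 4
  -- the trivial bound
  have htriv : ‖∑ n ∈ Ioc 0 x, (μ n : ℝ) • g n‖ ≤ x := by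
    have := norm_sum_moebius_smul_le_card (Ioc 0 x) hg1
    simpa using this
  set L := Nat.log 2 x with hL
  have hx0 : x ≠ 0 := by omega
  have hxL : 2 ^ L ≤ x := by rw [hL]; exact Nat.pow_log_le_self 2 hx0
  have hxL' : x < 2 ^ (L + 1) := by rw [hL]; exact Nat.lt_pow_succ_log_self (by norm_num) x
  -- `ρt < (L+1)/80`
  have hρtL : (ρt : ℝ) ≤ ((L : ℝ) + 1) / 80 := by
    have h1 : Real.log (x : ℝ) < (L + 1) * Real.log 2 := by
      have : (x : ℝ) < (2 : ℝ) ^ (L + 1) := by exact_mod_cast hxL'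
      have := Real.log_lt_log hxpos this
      rw [Real.log_pow] at this
      push_cast at this
      exact this
    have h2 : Real.log x / (80 * Real.log 2) ≤ ((L : ℝ) + 1) / 80 := by
      rw [div_le_div_iff₀ (by positivity) (by norm_num)]
      nlinarith
    linarith
  by_cases hneg : γ (2 * (ρt : ℝ)) < 0
  · -- negative exponent: the trivial bound
    have hE1 : 1 ≤ E := by
      rw [hE]; exact Real.one_le_rpow (by norm_num) (by linarith)
    have hA1 : (1 : ℝ) ≤ (32 * Kp + 10) * Real.log x ^ 4 := by
      calc (1 : ℝ) ≤ 10 * (1 / 5) := by norm_num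
        _ ≤ (32 * Kp + 10) * Real.log x ^ 4 := mul_le_mul (by linarith) hlog4 (by norm_num) (by positivity)
    calc ‖∑ n ∈ Ioc 0 x, (μ n : ℝ) • g n‖ ≤ x := htriv
      _ = 1 * x * 1 := by ring
      _ ≤ (32 * Kp + 10) * Real.log x ^ 4 * x * E :=
          mul_le_mul (mul_le_mul_of_nonneg_right hA1 (by positivity)) hE1 (by norm_num) (by positivity)
  push Not at hneg
  by_cases hsmall : L < 1400
  · -- small `x`: the trivial bound
    have hLs : L < 1400 := hsmall
    have hρt18 : (ρt : ℝ) ≤ 18 := by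
      have : (L : ℝ) ≤ 1399 := by exact_mod_cast (by omega : L ≤ 1399)
      linarith
    have hE12 : 1 / 2 ≤ E := by
      rw [hE, show (1:ℝ)/2 = (2:ℝ) ^ (-(1:ℝ)) by norm_num]
      exact Real.rpow_le_rpow_of_exponent_le (by norm_num) (by linarith)
    calc ‖∑ n ∈ Ioc 0 x, (μ n : ℝ) • g n‖ ≤ x := htriv
      _ = 10 * (1 / 5) * x * (1 / 2) := by ring
      _ ≤ (32 * Kp + 10) * Real.log x ^ 4 * x * E := by
          gcongr
          linarith
  -- large `x`
  push Not at hsmall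
  have hL1400 : 1400 ≤ L := hsmall
  set I := L / 4 + 1 with hI
  have hdec := sum_Ioc_eq_sum_pieces (fun n => (μ n : ℝ) • g n) x I
  rw [hdec]
  set Λx : ℝ := 1 + Real.log (2 * x) with hΛx
  have hΛxe : Λx = 1 + Real.log 2 + Real.log x := by
    rw [hΛx, Real.log_mul (by norm_num) (by positivity)]; ring
  have hΛx1 : 1 ≤ Λx := by rw [hΛxe]; linarith
  have hlogx17 : 1 + Real.log 2 ≤ Real.log x := by
    have h1 : ((2 : ℝ) ^ L) ≤ x := by exact_mod_cast hxL
    have h := Real.log_le_log (by positivity) h1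
    rw [Real.log_pow] at h
    have hL' : (1400 : ℝ) ≤ L := by exact_mod_cast hL1400
    nlinarith
  have hΛx2 : Λx ≤ 2 * Real.log x := by rw [hΛxe]; linarith
  -- the shallow pieces
  have hpiece : ∀ i ∈ range I, ‖∑ n ∈ (Ioc 0 (x / 2 ^ i)).filter (fun n => x / 2 ^ i < 2 * n),
      (μ n : ℝ) • g n‖ ≤ Kp * x * Λx ^ 4 * E * (1 / 2) ^ i := by
    intro i hi
    rw [mem_range] at hi
    have hiL : i ≤ L / 4 := by omega
    set y := x / 2 ^ i with hy
    have hyL : Nat.log 2 y = L - i := by rw [hy, hL]; exact natLog_two_div_pow hx0 (by omega)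
    have hy1024 : 1024 ≤ Nat.log 2 y := by rw [hyL]; omega
    have hyge : 2 ^ (L - i) ≤ y := by
      rw [hy, Nat.le_div_iff_mul_le (by positivity), ← pow_add]
      calc 2 ^ (L - i + i) = 2 ^ L := by congr 1; omega
        _ ≤ x := hxL
    have hlam₀ : 2 * (ρt : ℝ) ≤ (Nat.log 2 y : ℝ) / 25 := by
      rw [hyL]
      have h1 : ((L - i : ℕ) : ℝ) = (L : ℝ) - i := by push_cast [Nat.cast_sub (show i ≤ L by omega)]; ring
      rw [h1]
      have h2 : (i : ℝ) ≤ (L : ℝ) / 4 := by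
        have : ((i : ℕ) : ℝ) * 4 ≤ L := by exact_mod_cast (by omega : i * 4 ≤ L)
        linarith
      have hL' : (1400 : ℝ) ≤ L := by exact_mod_cast hL1400
      linarith
    have h := piece_le hU hcarry hc hfourU hmono h26 ϑ hy1024 hlam₀ hneg
    -- compare `y` with `x/2^i` and `Λ_y` with `Λ_x`
    have hyx : (y : ℝ) ≤ x * (1 / 2) ^ i := by
      rw [hy]
      calc ((x / 2 ^ i : ℕ) : ℝ) ≤ (x : ℝ) / ((2 ^ i : ℕ) : ℝ) := Nat.cast_div_le
        _ = x * (1 / 2) ^ i := by push_cast; rw [one_div, inv_pow, div_eq_mul_inv]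
    have hypos : (0 : ℝ) < y := by
      have : 0 < y := lt_of_lt_of_le (by positivity) hyge
      exact_mod_cast this
    have hΛy : 1 + Real.log (2 * (y : ℝ)) ≤ Λx := by
      rw [hΛx]
      have : (y : ℝ) ≤ x := by rw [hy]; exact_mod_cast Nat.div_le_self _ _
      have := Real.log_le_log (by positivity) (by linarith : 2 * (y : ℝ) ≤ 2 * x)
      linarith
    have hΛy0 : 0 ≤ 1 + Real.log (2 * (y : ℝ)) := by
      have : 0 ≤ Real.log (2 * (y : ℝ)) := Real.log_nonneg (by
        have : (1:ℝ) ≤ y := by exact_mod_cast hypos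
        linarith)
      linarith
    calc _ ≤ Kp * y * (1 + Real.log (2 * y)) ^ 4 * (2 : ℝ) ^ (-γ (2 * (ρt : ℝ)) / 20) := h
      _ ≤ Kp * (x * (1 / 2) ^ i) * Λx ^ 4 * E := by
          rw [hE]
          exact mul_le_mul (mul_le_mul (mul_le_mul_of_nonneg_left hyx hKp0) (pow_le_pow_left₀ hΛy0 hΛy 4)
            (by positivity) (by positivity)) le_rfl (by positivity) (by positivity)
      _ = _ := by ring
  -- the deep part
  have htail : ‖∑ n ∈ Ioc 0 (x / 2 ^ I), (μ n : ℝ) • g n‖ ≤ x * E := by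
    have h1 := norm_sum_moebius_smul_le_card (Ioc 0 (x / 2 ^ I)) hg1
    rw [Nat.card_Ioc, Nat.sub_zero] at h1
    refine h1.trans ?_
    have h2 : ((x / 2 ^ I : ℕ) : ℝ) ≤ (x : ℝ) / (2 : ℝ) ^ I := by
      have h' : ((x / 2 ^ I : ℕ) : ℝ) ≤ (x : ℝ) / ((2 ^ I : ℕ) : ℝ) := Nat.cast_div_le
      push_cast at h'
      exact h'
    have h3 : (x : ℝ) / (2 : ℝ) ^ I = x * (2 : ℝ) ^ (-(I : ℝ)) := by
      rw [Real.rpow_neg (by norm_num), Real.rpow_natCast, div_eq_mul_inv]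
    have h4 : (2 : ℝ) ^ (-(I : ℝ)) ≤ E := by
      rw [hE]
      refine Real.rpow_le_rpow_of_exponent_le (by norm_num) ?_
      have : ((L : ℝ) + 1) / 80 ≤ I := by
        rw [hI]; push_cast
        have : ((L : ℝ)) ≤ 4 * ((L / 4 : ℕ) : ℝ) + 3 := by
          have := Nat.div_add_mod L 4
          have h' : ((4 * (L / 4) + L % 4 : ℕ) : ℝ) = L := by exact_mod_cast this
          push_cast at h'
          have h'' : ((L % 4 : ℕ) : ℝ) ≤ 3 := by exact_mod_cast (by omega : L % 4 ≤ 3)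
          linarith
        linarith
      linarith
    calc ((x / 2 ^ I : ℕ) : ℝ) ≤ (x : ℝ) / (2 : ℝ) ^ I := h2
      _ = x * (2 : ℝ) ^ (-(I : ℝ)) := h3
      _ ≤ x * E := mul_le_mul_of_nonneg_left h4 (by positivity)
  -- assemble
  have hgeom := sum_geometric_two_le I
  calc ‖∑ i ∈ range I, ∑ n ∈ (Ioc 0 (x / 2 ^ i)).filter (fun n => x / 2 ^ i < 2 * n), (μ n : ℝ) • g n +
        ∑ n ∈ Ioc 0 (x / 2 ^ I), (μ n : ℝ) • g n‖
      ≤ ‖∑ i ∈ range I, ∑ n ∈ (Ioc 0 (x / 2 ^ i)).filter (fun n => x / 2 ^ i < 2 * n), (μ n : ℝ) • g n‖ +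
          ‖∑ n ∈ Ioc 0 (x / 2 ^ I), (μ n : ℝ) • g n‖ := norm_add_le _ _
    _ ≤ ∑ i ∈ range I, ‖∑ n ∈ (Ioc 0 (x / 2 ^ i)).filter (fun n => x / 2 ^ i < 2 * n), (μ n : ℝ) • g n‖ +
          x * E := add_le_add (norm_sum_le _ _) htail
    _ ≤ ∑ i ∈ range I, Kp * x * Λx ^ 4 * E * (1 / 2) ^ i + x * E := by
        gcongr with i hi
        exact hpiece i hi
    _ = Kp * x * Λx ^ 4 * E * ∑ i ∈ range I, (1 / 2 : ℝ) ^ i + x * E := by rw [mul_sum]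
    _ ≤ Kp * x * Λx ^ 4 * E * 2 + x * E := by gcongr
    _ ≤ Kp * x * (2 * Real.log x) ^ 4 * E * 2 + x * E := by gcongr
    _ = (32 * Kp) * Real.log x ^ 4 * x * E + x * E := by ring
    _ ≤ (32 * Kp) * Real.log x ^ 4 * x * E + 10 * Real.log x ^ 4 * x * E := by
        have : x * E ≤ 10 * Real.log x ^ 4 * x * E := by
          have h1 : (1 : ℝ) ≤ 10 * Real.log x ^ 4 := by linarith
          have h0 : 0 ≤ x * E := by positivity
          nlinarith
        linarith
    _ = (32 * Kp + 10) * Real.log x ^ 4 * x * E := by ring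

end Literature.NumberTheory.LFunctions
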